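import Literature.MathematicalPhysics.QuantumFieldTheory.Balaban1983to89.B6Prop22DerivTwoLevelBox
import Literature.MathematicalPhysics.QuantumFieldTheory.Balaban1983to89.B6Ineq243AdjTwoLevelBox

/-!
# `Balaban1983to89.B6Prop22AdjTwoLevelBox` — [B6] Proposition 2.2, THIRD ENTRY of (2.67), `|(G′∇*λ)(x)| ≤
O(1)L^jηe^{−½δ₀d(y,y′)}|λ|`, ALONG THE PRINTED ROUTE FOR THE GENUINE TWO-LEVEL OPERATOR `Δ_Ω^{L^{−j},N} + m² + Q′*aQ′` ON
A BOX OF `L`-BLOCKS — uniformly in the mesh and the volume (file 7 of the two-level parametrix; nothing existing is touched;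
no fact is minted)

FRAMING (verbatim cell line):
statement-level skeleton of published theorems with citation tags; proofs where landed; nothing here is a claim about the Yang–Mills mass gap

Source under audit (cell pub-balaban): T. Bałaban, *Propagators and renormalization transformations for lattice gauge
theories. II*, Commun. Math. Phys. **96** (1984) 223–250 [`Balaban1984PropagatorsII`, "B6"], p. 229 [PDF 7] (2.37)–(2.38),
p. 230 [PDF 8] (2.40)/(2.44), p. 232 [PDF 10] (2.49)–(2.51), p. 234 [PDF 12] (2.64)–(2.67), Proposition 2.2 (renders
`b2b-balaban-ref1/pages/1984-cmp96-propagators-rt-II/…-p007/p008/p010/p012-x2.png`, p012 read as an image this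
generation); the `G_k(□)D^{η*}_μ` clause of [3] = T. Bałaban, Commun. Math. Phys. **89** (1983) Lemma 2.2 (2.17)
pp. 577–578 enters BY NAME through `B6Ineq243AdjTwoLevelBox.ineq243_twoLevel_dstar_roww`.

## WHAT IS PRINTED (p. 234, verbatim up to notation)

«The similar inequalities hold for a derivative of G′λ and for a Hölder norm of a derivative, but with (L^jη)² replaced
by L^jη and (L^jη)^{1−α} correspondingly. Let us formulate these results in Proposition 2.2. If we have (2.1), (2.2) and
M is sufficiently large, then the operator G′ = Δ′_a^{−1}(a = 1) satisfies the inequalities |(G′λ)(x)|, |(∇G′λ)(x)|,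
|(G′∇*λ)(x)|, ‖ζ∇G′λ‖_α, ‖ζG′∇*λ‖_α, |(ΔG′λ)(x)| ≤ O(1)[(L^jη)², L^jη, L^jη, (L^jη)^{1−α}(‖ζ‖_α + |ζ|),
(L^jη)^{1−α}(‖ζ‖_α + |ζ|), 1]·e^{−½δ₀d(y,y′)}|λ|, x ∈ B^j(y) or supp ζ ⊂ B^j(y), y ∈ Λ_j, supp λ ⊂ B^{j′}(y′), y′ ∈ Λ_{j′}.
(2.67) The random walk representation (2.50) is convergent in the norms defined by these inequalities.»

## WHAT THIS FILE CERTIFIES (kernel-checked; `A = 0`; the lineage is USED, not re-proved)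

Setting and notation of `B6Prop22TwoLevelBox` (`n = L^k`, `ξ = 1/n`, `M = L·M_h`, `Ω` the box of `L`-blocks,
`E = twoLevelOp`, `G′ = gTwoLevel = E^{−1}`, `G′₀ = B6Eq250.gZero hDiag gPad`, `R = B6Eq250.rOp E hDiag gPad`).  The THIRD
entry of (2.67) concerns `G′∇*`: its kernel along the axis `μ` is `dstar n μ G′ (x, z) = ξ^{−1}(G′(x, fwd_μ z) − G′(x, z))`
(`B6Ineq243AdjTwoLevelBox.dstar`, bond variable `z`; the pairing identity `gTwoLevel_box_dstar_pairing`
`⟨g, (dstar G′)f⟩ = ⟨∂^ξ_μ(G′g), f⟩` certifies the dictionary), and «the norm defined by the inequality» is the weighted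
row functional of this kernel, `roww_δ(dstar G′)(x) = Σ_z|ξ^{−1}(G′(x, fwd_μ z) − G′(x, z))|e^{δ|x−z|_∞/n}` — by the
symmetry of `G′` a weighted COLUMN sum of the derivative kernel `∂_μG′`, which is why the resummation (2.50) is run in
its TRANSPOSED form `G′ = G′₀ + RᵀG′` and needs the weighted COLUMNS of `R` to be small:
* §1–§2 bookkeeping (`roww` of `u·T` and of `−T`, sums over the image of the cube embedding, entries of padded cube
  kernels, the mirror `exists_emb_pair_of_hΩ_fwd_ne_zero` of gen-8's pair lemma: a bond with an end-point carrying `h_q`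
  lies in `□_q`);
* §3 **the (2.64)-input for `G′₀∂^*`** `roww_dstar_gZero_le`: `sup_x roww_{δ₂}(dstar G′₀)(x) ≤ C₀` uniformly (mesh
  `k ≥ 1`, `M_h ≥ 1`, volume, block union, window, axis) — product rule in the bond variable, (2.43) for `G′(□_q)∂^*`
  (`ineq243_twoLevel_dstar_roww`) and (2.43)₁ on the cut cubes, `ξ^{−1}|h_q(fwd z) − h_q(z)| ≤ (d+1)sup|h′|`, finite overlap;
* §4 **the transposed (2.40)/(2.44), deterministic** `wsum_kComm_le`: for the genuine two-level operator, any cut-off `h`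
  (unit-scale Lipschitz `κ₁`, Laplacian `κ₂`) and ANY `u`,
  `Σ_z|(K(h)u)(z)|e^{δ|x−z|_∞/n} ≤ κ₁(1+e^{δ})Σ_μΣ_z|∂^ξ_μu(z)|e^{…} + (κ₂ + (a_j+a)Le^{δL}κ₁)Σ_z|u(z)|e^{…}` (the three terms
  of (2.40), `B6Ineq243TwoLevelBox.eq240_twoLevel`, summed against the weight: bond resummation `weighted_star_absDiff_le`,
  symmetry of the averaging entries `vEntry_comm`);
* §5 **the transposed (2.49)/(2.51)** `roww_transpose_rOp_le`: `sup_x Σ_z|R(z,x)|e^{δ₃|z−x|_∞/n} ≤ C_R/M` for every mesh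
  `k ≥ 1`, `M_h ≥ 3`, volume, block union, window — `Rᵀ = −Σ_q resᵀ·h_qG′(□_q)K_q(h_q)·res` (`K(h)ᵀ = −K(h)`,
  `kComm_transpose`; `G′(□_q)` symmetric), the row `a` of `G′(□_q)K_q(h_q)` is `−K_q(h_q)` on the row `a` of `G′(□_q)`
  (`roww_mul_kComm`), §4 with the bond sums of `G′(□_q)∂^*` and the rows of `G′(□_q)`, the sizes `κ₁ = (d+1)sup|h′|/M`,
  `κ₂ = (d+1)sup|h″|/M²` (`hLoc_lipschitz`, `hLoc_laplacian_le`) and the finite overlap (`roww_transpose_bPad_le`);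
* §6 **(2.67)₃ ALONG THE PRINTED ROUTE** `prop22_entry3_twoLevelBox`: there are `δ, M₀, C > 0` (functions of `d`, `ℓ`,
  window) such that for EVERY `k ≥ 1`, `M_h ≥ 3` with `L·M_h ≥ M₀`, volume, block union, window point, axis `μ` and site
  `x ∈ Ω`: `roww_δ(dstar G′)(x) ≤ C` — from `dstar G′ = dstar G′₀ + Rᵀ·dstar G′` (`gTwoLevel_eq_gZero_add_transpose`,
  `dstar_mul`), `roww(Rᵀ·D) ≤ roww(Rᵀ)·sup roww(D)` and `sup roww(Rᵀ) ≤ C_R/M ≤ ½`; the kernel decay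
  `gTwoLevel_dstar_entry_decay` and the printed value form `gTwoLevel_dstar_value_decay`:
  `|(G′∂^{ξ*}_μf)(x)| ≤ Ce^{−δD/n}F` for bond functions `|f| ≤ F` supported at sup-distance `≥ D` from `x`.

## HONEST SCOPE

As in `B6Prop22TwoLevelBox`: `k = 1` (two levels), `A = 0`, Neumann box for the torus, one cube size, existential
constants (no numerical `½δ₀`; `L^jη ↦ 1` in the lattice units of `twoLevelOp`); AS A BOUND the result is one line from
(2.43) for `G′(Ω)∂^*` on `Ω` itself (`ineq243_twoLevel_dstar_roww`) — certified is the printed ROUTE (2.38)/(2.50) →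
(2.51) → (2.64)–(2.66), here necessarily in the transposed (column) form, which print does not spell out («The similar
inequalities hold …»).  The Hölder entries and `ΔG′` of (2.67) are not treated.  Every step is kernel-checked.
-/

namespace Literature.MathematicalPhysics.QuantumFieldTheory.Balaban1983to89.B6Prop22AdjTwoLevelBox

open Finset Matrix
open Literature.MathematicalPhysics.QuantumFieldTheory.Balaban1983to89.B4Reflection242 (boxDom mem_boxDom nbrs mem_nbrs)
open Literature.MathematicalPhysics.QuantumFieldTheory.Balaban1983to89.B4ContourShift (supNorm supNorm_nonneg)
open Literature.MathematicalPhysics.QuantumFieldTheory.Balaban1983to89.B4Lemma22ReduceZero (Box)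
open Literature.MathematicalPhysics.QuantumFieldTheory.Balaban1983to89.B4Thm110ZeroBox (roww roww_nonneg roww_add_le
  mulVec_le_of_roww supNorm_sub_le_sub_add_sub)
open Literature.MathematicalPhysics.QuantumFieldTheory.Balaban1983to89.B4Thm110ZeroBoxDeriv (supNorm_single_le)
open Literature.MathematicalPhysics.QuantumFieldTheory.Balaban1983to89.B4PartitionUnity22 (hprof D1 D1_nonneg
  contDiff_hprof hasCompactSupport_hprof)
open Literature.MathematicalPhysics.QuantumFieldTheory.Balaban1983to89.B4Lemma22ZeroBoxDerivDual (fwd fwd_spec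
  fwd_eq_of_nbr)
open Literature.MathematicalPhysics.QuantumFieldTheory.Balaban1983to89.B6Ineq243TwoLevelBox
open Literature.MathematicalPhysics.QuantumFieldTheory.Balaban1983to89.B6Partition236TwoLevelBox
open Literature.MathematicalPhysics.QuantumFieldTheory.Balaban1983to89.B6Eq238TwoLevelBox
open Literature.MathematicalPhysics.QuantumFieldTheory.Balaban1983to89.B6Ineq249TwoLevelBox
open Literature.MathematicalPhysics.QuantumFieldTheory.Balaban1983to89.B6Prop22TwoLevelBox
open Literature.MathematicalPhysics.QuantumFieldTheory.Balaban1983to89.B6Ineq243AdjTwoLevelBox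

noncomputable section

variable {d : ℕ}

/-! ## §1 Bookkeeping -/

section Tools

variable {N : Fin (d + 1) → ℕ}

/-- `roww` of `u·T` (a multiplication operator on the left): `= |u(x)|·roww(T)(x)` (bookkeeping for the weighted rows
of (2.43)/(2.64)). [cite: Balaban1984PropagatorsII, (2.43) p.230, bookkeeping] -/
theorem roww_diagonal_mul (δ : ℝ) (n : ℕ) (u : ↥(boxDom N) → ℝ) (T : Matrix ↥(boxDom N) ↥(boxDom N) ℝ)
    (x : ↥(boxDom N)) : roww δ n (Matrix.diagonal u * T) x = |u x| * roww δ n T x := by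
  unfold roww
  rw [Finset.mul_sum]
  refine Finset.sum_congr rfl fun x' _ => ?_
  rw [Matrix.diagonal_mul, abs_mul, mul_assoc]

/-- `roww` is blind to the sign of the kernel (bookkeeping for the weighted rows of (2.43)/(2.64)).
[cite: Balaban1984PropagatorsII, (2.43) p.230, bookkeeping] -/
theorem roww_neg (δ : ℝ) (n : ℕ) (T : Matrix ↥(boxDom N) ↥(boxDom N) ℝ) (x : ↥(boxDom N)) :
    roww δ n (-T) x = roww δ n T x := by
  unfold roww
  exact Finset.sum_congr rfl fun x' _ => by rw [Matrix.neg_apply, abs_neg]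

/-- a sum over a finite type of a function vanishing off the image of an injection is the sum over the source. [folklore] -/
private theorem sum_eq_sum_image {α β : Type*} [Fintype α] [Fintype β] [DecidableEq β] {e : α → β}
    (he : Function.Injective e) (F : β → ℝ) (hF : ∀ z, (∀ a, e a ≠ z) → F z = 0) : ∑ z, F z = ∑ a, F (e a) := by
  calc ∑ z, F z = ∑ z ∈ Finset.univ.image e, F z :=
        (Finset.sum_subset (Finset.subset_univ _) fun z _ hz =>
          hF z fun a ha => hz (Finset.mem_image.2 ⟨a, Finset.mem_univ _, ha⟩)).symm
    _ = ∑ a, F (e a) := Finset.sum_image fun a _ a' _ h => he h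

/-- a sum of non-negative terms, each `≤ B`, non-zero only on terms indexed injectively by `T`: `≤ |T|·B`. [folklore] -/
private theorem sum_le_card_mul₃ {ι σ : Type*} [Fintype ι] [DecidableEq σ] (f : ι → ℝ) (key : ι → σ)
    (hkey : Function.Injective key) (T : Finset σ) (hT : ∀ i, f i ≠ 0 → key i ∈ T) {B : ℝ} (hB : 0 ≤ B)
    (hf : ∀ i, f i ≤ B) : ∑ i, f i ≤ T.card * B := by
  classical
  rw [← Finset.sum_filter_ne_zero]
  have hcard : (Finset.univ.filter fun i => f i ≠ 0).card ≤ T.card :=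
    Finset.card_le_card_of_injOn key (fun i hi => by
      rw [Finset.coe_filter] at hi; exact hT i hi.2) (fun i _ j _ h => hkey h)
  calc ∑ i ∈ Finset.univ.filter (fun i => f i ≠ 0), f i
      ≤ (Finset.univ.filter fun i => f i ≠ 0).card • B := Finset.sum_le_card_nsmul _ _ _ fun i _ => hf i
    _ = ((Finset.univ.filter fun i => f i ≠ 0).card : ℝ) * B := by rw [nsmul_eq_mul]
    _ ≤ T.card * B := by gcongr

/-- the bond `⟨z, fwd_μ z⟩` has length `≤ 1` (in fine units; `= ξ` on the `ξ`-lattice, `0` where there is no bond).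
[cite: Balaban1983RegularityDecay, (1.3) p.572 («bonds b = ⟨b₋, b₊⟩ with end-points b₋, b₊ in Ω»), dictionary] -/
theorem supNorm_fwd_sub_le (μ : Fin (d + 1)) (z : ↥(boxDom N)) : supNorm ((fwd N μ z).1 - z.1) ≤ 1 := by
  rcases fwd_spec μ z with e | e
  · rw [e, add_sub_cancel_left]
    exact supNorm_single_le μ
  · rw [e, sub_self, B4BoxCov237.supNorm_zero']
    exact zero_le_one

end Tools

/-! ## §2 The padded cube kernels against `dstar` -/

section Pad

variable {ℓ k Mh : ℕ} {P : Fin (d + 1) → ℕ} {q : Fin (d + 1) → ℤ}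

/-- an entry of a padded cube kernel at an embedded pair is the cube entry. [cite: Balaban1983RegularityDecay, §2 p.575, dictionary] -/
theorem pad_apply_emb (hP : ∀ i, 1 ≤ P i) (hq : q ∈ ctrs P)
    (T : Matrix ↥(Box d ℓ k (fun i => (ℓ + 1) * cubeM' Mh P q i)) ↥(Box d ℓ k (fun i => (ℓ + 1) * cubeM' Mh P q i)) ℝ)
    (a b : ↥(Box d ℓ k (fun i => (ℓ + 1) * cubeM' Mh P q i))) :
    ((res (emb ℓ k Mh P q hP hq))ᵀ * T * res (emb ℓ k Mh P q hP hq)) (emb ℓ k Mh P q hP hq a) (emb ℓ k Mh P q hP hq b)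
      = T a b := by
  have hinj := emb_injective (ℓ := ℓ) (k := k) (Mh := Mh) hP hq
  rw [mul_res_apply_img hinj, transpose_res_mul_apply_img hinj]

/-- a row of a padded cube kernel off the cube vanishes. [cite: Balaban1983RegularityDecay, §2 p.575, dictionary] -/
theorem pad_apply_row_off (hP : ∀ i, 1 ≤ P i) (hq : q ∈ ctrs P)
    (T : Matrix ↥(Box d ℓ k (fun i => (ℓ + 1) * cubeM' Mh P q i)) ↥(Box d ℓ k (fun i => (ℓ + 1) * cubeM' Mh P q i)) ℝ)
    {x : ↥(Box d ℓ k (fun i => (ℓ + 1) * (Mh * P i)))} (hx : ∀ a, emb ℓ k Mh P q hP hq a ≠ x)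
    (w : ↥(Box d ℓ k (fun i => (ℓ + 1) * (Mh * P i)))) :
    ((res (emb ℓ k Mh P q hP hq))ᵀ * T * res (emb ℓ k Mh P q hP hq)) x w = 0 := by
  rw [Matrix.mul_assoc, transpose_res_mul_apply_off _ _ hx]

/-- a column of a padded cube kernel off the cube vanishes. [cite: Balaban1983RegularityDecay, §2 p.575, dictionary] -/
theorem pad_apply_col_off (hP : ∀ i, 1 ≤ P i) (hq : q ∈ ctrs P)
    (T : Matrix ↥(Box d ℓ k (fun i => (ℓ + 1) * cubeM' Mh P q i)) ↥(Box d ℓ k (fun i => (ℓ + 1) * cubeM' Mh P q i)) ℝ)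
    (x : ↥(Box d ℓ k (fun i => (ℓ + 1) * (Mh * P i))))
    {w : ↥(Box d ℓ k (fun i => (ℓ + 1) * (Mh * P i)))} (hw : ∀ b, emb ℓ k Mh P q hP hq b ≠ w) :
    ((res (emb ℓ k Mh P q hP hq))ᵀ * T * res (emb ℓ k Mh P q hP hq)) x w = 0 :=
  mul_res_apply_off _ _ _ hw

/-- the MIRROR of `B6Prop22DerivTwoLevelBox.exists_emb_pair_of_hΩ_ne_zero`: a backward neighbour `x` of a site `x + e_μ`
carrying `h_q` lies in the cube `□_q` together with it. [cite: Balaban1983RegularityDecay, (2.6) p.576] -/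
theorem exists_emb_pair_of_hΩ_fwd_ne_zero (hℓ : 1 ≤ ℓ) (hk : 1 ≤ k) (hMh : 1 ≤ Mh) (hP : ∀ i, 1 ≤ P i)
    (hq : q ∈ ctrs P) {μ : Fin (d + 1)}
    {x xe : ↥(Box d ℓ k (fun i => (ℓ + 1) * (Mh * P i)))} (hxe : xe.1 = x.1 + Pi.single μ 1)
    (hx : hΩ ℓ k Mh P q xe ≠ 0) :
    ∃ a ae : ↥(Box d ℓ k (fun i => (ℓ + 1) * cubeM' Mh P q i)),
      emb ℓ k Mh P q hP hq a = x ∧ emb ℓ k Mh P q hP hq ae = xe ∧ ae.1 = a.1 + Pi.single μ 1 := by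
  obtain ⟨ae, rfl, hae⟩ := hΩ_support hℓ hk hMh hP hq xe hx
  obtain ⟨a, ha⟩ := exists_emb_eq_of_nbr hP hq hae (x := x)
    (mem_nbrs.2 ⟨μ, Or.inr (by rw [hxe, add_sub_cancel_right])⟩)
  refine ⟨a, ae, ha, rfl, ?_⟩
  have h := emb_sub_emb hP hq ae a
  rw [ha, hxe, add_sub_cancel_left] at h
  rw [h, add_sub_cancel]

end Pad

/-! ## §3 The (2.64)-input for `G′₀∂^*`: the weighted rows of `dstar G′₀` -/

section GZeroAdj

variable {ℓ k Mh : ℕ} {P : Fin (d + 1) → ℕ}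

/-- **THE WEIGHTED ROWS OF `dstar G′₀`** (`G′₀ = Σ_q h_qG′(□_q)h_q`): for every window there are `δ₂, C₀ > 0` with
`Σ_z|ξ^{−1}(G′₀(x, fwd_μ z) − G′₀(x, z))|e^{δ₂|x−z|_∞/n} ≤ C₀` for every mesh `k ≥ 1`, `M_h ≥ 1`, volume, block union,
window point, axis `μ` and site `x` — by the product rule in the bond variable
`ξ^{−1}(Ĝ_q(x,fwd z)h_q(fwd z) − Ĝ_q(x,z)h_q(z)) = ξ^{−1}(Ĝ_q(x,fwd z) − Ĝ_q(x,z))·h_q(fwd z) + Ĝ_q(x,z)·ξ^{−1}(h_q(fwd z) − h_q(z))`,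
the (2.43)-estimate for `G′(□_q)∂^*` on the cut cube (`B6Ineq243AdjTwoLevelBox.ineq243_twoLevel_dstar_roww`, applicable
because a bond with an end-point carrying `h_q` lies in `□_q`: `exists_emb_pair_of_hΩ_fwd_ne_zero`), (2.43)₁
(`ineq243_twoLevel_roww`), the unit-scale size `ξ^{−1}|h_q(fwd z) − h_q(z)| ≤ (d+1)sup|h′|`
(`B6Partition236TwoLevelBox.abs_hq_sub_le`) and the finite overlap (`≤ 2^{d+1}` cubes carry `h_q(x) ≠ 0`).
[cite: Balaban1984PropagatorsII, (2.64) p.234 (the `G′∇*` clause of (2.67)), (2.43) p.230] -/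
theorem roww_dstar_gZero_le (d ℓ : ℕ) (hℓ : 1 ≤ ℓ) (aminus aplus m2plus a2minus a2plus : ℝ) (ha : 0 < aminus)
    (ha2 : 0 < a2minus) :
    ∃ δ₂ C₀ : ℝ, 0 < δ₂ ∧ 0 < C₀ ∧ ∀ (k : ℕ), 1 ≤ k → ∀ (aj m2 a : ℝ), aminus ≤ aj → aj ≤ aplus → 0 ≤ m2 →
      m2 ≤ m2plus → a2minus ≤ a → a ≤ a2plus → ∀ (Mh : ℕ), 1 ≤ Mh → ∀ (P : Fin (d + 1) → ℕ) (hP : ∀ i, 1 ≤ P i)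
        (Λ : Finset ↥(boxDom (fun i => (ℓ + 1) * (Mh * P i)))) (μ : Fin (d + 1))
        (x : ↥(Box d ℓ k (fun i => (ℓ + 1) * (Mh * P i)))),
          roww δ₂ ((ℓ + 1) ^ k) (dstar ((ℓ + 1) ^ k) μ
            (B6Eq250.gZero (hDiag ℓ k Mh P) (gPad ℓ k Mh P aj a m2 Λ hP))) x ≤ C₀ := by
  obtain ⟨δa, c', hδa, hc', h243⟩ := ineq243_twoLevel_roww d ℓ hℓ aminus aplus m2plus a2minus a2plus ha ha2
  obtain ⟨δb, cs, hδb, hcs, h243s⟩ := ineq243_twoLevel_dstar_roww d ℓ hℓ aminus aplus m2plus a2minus a2plus ha ha2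
  have hD1 := D1_nonneg contDiff_hprof hasCompactSupport_hprof
  set δ₂ : ℝ := min δa δb with hδ₂
  have hδ₂0 : 0 < δ₂ := lt_min hδa hδb
  set κ : ℝ := (d + 1) * D1 hprof with hκ
  have hκ0 : 0 ≤ κ := by rw [hκ]; positivity
  set B : ℝ := cs + κ * c' with hB
  have hB0 : 0 ≤ B := by rw [hB]; positivity
  refine ⟨δ₂, 2 ^ (d + 1) * B + 1, hδ₂0, by positivity, ?_⟩
  intro k hk aj m2 a e1 e2 e3 e4 e5 e6 Mh hMh P hP Λ μ x
  have hn1 : 1 ≤ (ℓ + 1) ^ k := Nat.one_le_pow _ _ (by omega)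
  have hN1 : 1 ≤ (ℓ + 1) ^ k * ((ℓ + 1) * Mh) := Nat.one_le_iff_ne_zero.2 (by positivity)
  have hnr : (0 : ℝ) < (((ℓ + 1) ^ k : ℕ) : ℝ) := by exact_mod_cast hn1
  have hM1 : (1 : ℝ) ≤ ((ℓ : ℝ) + 1) * Mh := by
    have : (1 : ℝ) ≤ Mh := by exact_mod_cast hMh
    have : (0 : ℝ) ≤ ℓ := Nat.cast_nonneg ℓ
    nlinarith
  set n : ℕ := (ℓ + 1) ^ k with hn
  have hM' : ∀ q : ↥(ctrs P), ∀ i, 1 ≤ cubeM' Mh P q.1 i := fun q i =>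
    Nat.one_le_iff_ne_zero.2 (Nat.mul_ne_zero_iff.2 ⟨by omega, by have := (one_le_cubeW hP q.2 i).1; omega⟩)
  -- the unit-scale size of the bond differences of `h_q`
  have hdh : ∀ (q : ↥(ctrs P)) (z : ↥(Box d ℓ k (fun i => (ℓ + 1) * (Mh * P i)))),
      |(n : ℝ) * (hΩ ℓ k Mh P q.1 (fwd _ μ z) - hΩ ℓ k Mh P q.1 z)| ≤ κ := by
    intro q z
    have h := abs_hq_sub_le (d := d) hn1 (Nat.one_le_iff_ne_zero.2 (by positivity : (ℓ + 1) * Mh ≠ 0)) q.1 z.1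
      (fwd _ μ z).1
    unfold hΩ
    rw [abs_mul, abs_of_nonneg (Nat.cast_nonneg _)]
    have hs := supNorm_fwd_sub_le μ z
    have hM'' : (1 : ℝ) ≤ (((ℓ + 1) * Mh : ℕ) : ℝ) := by push_cast; exact hM1
    calc ((n : ℕ) : ℝ) * |hq n ((ℓ + 1) * Mh) q.1 (fwd _ μ z).1 - hq n ((ℓ + 1) * Mh) q.1 z.1|
        ≤ ((n : ℕ) : ℝ) * ((d + 1) * D1 hprof / (((ℓ + 1) * Mh : ℕ) : ℝ) * supNorm ((fwd _ μ z).1 - z.1)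
            / ((n : ℕ) : ℝ)) := mul_le_mul_of_nonneg_left h (Nat.cast_nonneg _)
      _ = (d + 1) * D1 hprof / (((ℓ + 1) * Mh : ℕ) : ℝ) * supNorm ((fwd _ μ z).1 - z.1) := by
          field_simp
      _ ≤ (d + 1) * D1 hprof / (((ℓ + 1) * Mh : ℕ) : ℝ) * 1 :=
          mul_le_mul_of_nonneg_left hs (div_nonneg (mul_nonneg (by positivity) hD1) (Nat.cast_nonneg _))
      _ ≤ κ := by
          rw [mul_one, hκ]; exact div_le_self (mul_nonneg (by positivity) hD1) hM''
  -- per-cube bound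
  have hterm : ∀ q : ↥(ctrs P),
      roww δ₂ n (dstar n μ (B6Eq250.aTerm (hDiag ℓ k Mh P) (gPad ℓ k Mh P aj a m2 Λ hP) q)) x
        ≤ |hΩ ℓ k Mh P q.1 x| * B := by
    intro q
    set Pq := gPad ℓ k Mh P aj a m2 Λ hP q with hPq
    set h := hΩ ℓ k Mh P q.1 with hh
    -- the row bound of the padded cube propagator
    have hrowP : roww δ₂ n Pq x ≤ c' := by
      rw [hPq]
      unfold gPad cubeG
      by_cases hx : ∃ b, emb ℓ k Mh P q.1 hP q.2 b = x
      · obtain ⟨b, hb⟩ := hx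
        rw [← hb, roww_pad_emb hP q.2]
        exact (roww_mono (min_le_left _ _) _ _ _).trans
          (h243 k hk aj m2 a e1 e2 e3 e4 e5 e6 (cubeM' Mh P q.1) (hM' q) (lamLoc ℓ Mh P q.1 hP q.2 Λ) b)
      · push Not at hx
        rw [roww_pad_off hP q.2 _ _ _ hx]
        exact hc'.le
    -- the first piece: the padded `dstar` against `h(fwd z)`
    set F : ↥(Box d ℓ k (fun i => (ℓ + 1) * (Mh * P i))) → ℝ := fun z =>
      |(n : ℝ) * (Pq x (fwd _ μ z) - Pq x z)| * |h (fwd _ μ z)| * Real.exp (δ₂ * supNorm (x.1 - z.1) / n) with hF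
    have hF0 : ∀ z, 0 ≤ F z := fun z => by rw [hF]; positivity
    have hFsum : ∑ z, F z ≤ cs := by
      by_cases hx : ∃ a', emb ℓ k Mh P q.1 hP q.2 a' = x
      · obtain ⟨a', rfl⟩ := hx
        have hinj := emb_injective (ℓ := ℓ) (k := k) (Mh := Mh) hP q.2
        -- `F` vanishes off the image of `emb`
        have hoff : ∀ z, (∀ b, emb ℓ k Mh P q.1 hP q.2 b ≠ z) → F z = 0 := by
          intro z hz
          by_contra hne
          have h1 : h (fwd _ μ z) ≠ 0 := by
            intro h0; apply hne; rw [hF]; simp only; rw [h0, abs_zero, mul_zero, zero_mul]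
          rcases fwd_spec μ z with e | e
          · obtain ⟨b, -, hb, -, -⟩ := exists_emb_pair_of_hΩ_fwd_ne_zero hℓ hk hMh hP q.2 e h1
            exact hz b hb
          · apply hne; rw [hF]; simp only; rw [e, sub_self, mul_zero, abs_zero, zero_mul, zero_mul]
        rw [sum_eq_sum_image hinj F hoff]
        -- termwise comparison with the cube functional
        have hcmp : ∀ b, F (emb ℓ k Mh P q.1 hP q.2 b)
            ≤ |(n : ℝ) * (cubeG ℓ k Mh P aj a m2 Λ hP q a' (fwd _ μ b) - cubeG ℓ k Mh P aj a m2 Λ hP q a' b)|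
              * Real.exp (δ₂ * supNorm (a'.1 - b.1) / n) := by
          intro b
          by_cases h0 : h (fwd _ μ (emb ℓ k Mh P q.1 hP q.2 b)) = 0
          · rw [hF]; simp only; rw [h0, abs_zero, mul_zero, zero_mul]; positivity
          rcases fwd_spec μ (emb ℓ k Mh P q.1 hP q.2 b) with e | e
          · obtain ⟨b₀, be, hb₀, hbe, hstep⟩ := exists_emb_pair_of_hΩ_fwd_ne_zero hℓ hk hMh hP q.2 e h0
            have : b₀ = b := hinj hb₀
            subst this
            have hfb : fwd _ μ b₀ = be := fwd_eq_of_nbr μ b₀ be hstep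
            rw [hF]; simp only
            rw [← hbe, hfb, hPq]
            unfold gPad
            rw [pad_apply_emb hP q.2, pad_apply_emb hP q.2, emb_sub_emb hP q.2]
            exact mul_le_mul_of_nonneg_right (mul_le_of_le_one_right (abs_nonneg _) (abs_hq_le_one _ _ _ _))
              (Real.exp_pos _).le
          · rw [hF]; simp only; rw [e, sub_self, mul_zero, abs_zero, zero_mul, zero_mul]; positivity
        refine (Finset.sum_le_sum fun b _ => hcmp b).trans ?_
        have := (roww_mono (min_le_right δa δb) _ _ _).trans
          (h243s k hk aj m2 a e1 e2 e3 e4 e5 e6 (cubeM' Mh P q.1) (hM' q) (lamLoc ℓ Mh P q.1 hP q.2 Λ) μ a')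
        rw [roww_dstar] at this
        exact this
      · push Not at hx
        have : ∀ z, F z = 0 := fun z => by
          rw [hF]; simp only
          rw [hPq]; unfold gPad
          rw [pad_apply_row_off hP q.2 _ hx, pad_apply_row_off hP q.2 _ hx, sub_self, mul_zero, abs_zero, zero_mul,
            zero_mul]
        rw [Finset.sum_congr rfl fun z _ => this z, Finset.sum_const_zero]
        exact hcs.le
    -- assembling the product rule
    rw [B6Eq250.aTerm_apply]
    unfold hDiag
    rw [← hh, ← hPq]
    unfold roww
    have hent : ∀ z, |dstar n μ (Matrix.diagonal h * Pq * Matrix.diagonal h) x z|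
        * Real.exp (δ₂ * supNorm (x.1 - z.1) / n)
        ≤ |h x| * (F z + κ * (|Pq x z| * Real.exp (δ₂ * supNorm (x.1 - z.1) / n))) := by
      intro z
      rw [dstar_apply]
      simp only [Matrix.mul_diagonal, Matrix.diagonal_mul]
      have e : (n : ℝ) * (h x * Pq x (fwd _ μ z) * h (fwd _ μ z) - h x * Pq x z * h z)
          = h x * ((n : ℝ) * (Pq x (fwd _ μ z) - Pq x z) * h (fwd _ μ z)
            + Pq x z * ((n : ℝ) * (h (fwd _ μ z) - h z))) := by ring
      rw [e, abs_mul, mul_assoc]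
      refine mul_le_mul_of_nonneg_left ?_ (abs_nonneg _)
      calc |(n : ℝ) * (Pq x (fwd _ μ z) - Pq x z) * h (fwd _ μ z) + Pq x z * ((n : ℝ) * (h (fwd _ μ z) - h z))|
            * Real.exp (δ₂ * supNorm (x.1 - z.1) / n)
          ≤ (|(n : ℝ) * (Pq x (fwd _ μ z) - Pq x z)| * |h (fwd _ μ z)| + |Pq x z| * κ)
            * Real.exp (δ₂ * supNorm (x.1 - z.1) / n) := by
              refine mul_le_mul_of_nonneg_right ?_ (Real.exp_pos _).le
              refine (abs_add_le _ _).trans ?_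
              rw [abs_mul ((n : ℝ) * (Pq x (fwd _ μ z) - Pq x z)) (h (fwd _ μ z)), abs_mul (Pq x z)]
              have := hdh q z
              rw [← hh] at this
              exact add_le_add le_rfl (mul_le_mul_of_nonneg_left this (abs_nonneg _))
        _ = F z + κ * (|Pq x z| * Real.exp (δ₂ * supNorm (x.1 - z.1) / n)) := by rw [hF]; ring
    refine (Finset.sum_le_sum fun z _ => hent z).trans ?_
    rw [← Finset.mul_sum, Finset.sum_add_distrib, ← Finset.mul_sum]
    refine mul_le_mul_of_nonneg_left ?_ (abs_nonneg _)
    have hP' : ∑ z, |Pq x z| * Real.exp (δ₂ * supNorm (x.1 - z.1) / n) ≤ c' := hrowP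
    rw [hB]
    exact add_le_add hFsum (mul_le_mul_of_nonneg_left hP' hκ0)
  -- the overlap count
  rw [B6Eq250.gZero_eq_sum_aTerm, dstar_sum]
  refine (roww_sum_le _ _ _ _ x).trans ?_
  have hterm' : ∀ q : ↥(ctrs P),
      roww δ₂ n (dstar n μ (B6Eq250.aTerm (hDiag ℓ k Mh P) (gPad ℓ k Mh P aj a m2 Λ hP) q)) x ≤ B := fun q =>
    (hterm q).trans (by
      calc |hΩ ℓ k Mh P q.1 x| * B ≤ 1 * B := mul_le_mul_of_nonneg_right (abs_hq_le_one _ _ _ _) hB0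
        _ = B := one_mul _)
  have key := sum_le_card_mul₃
    (fun q : ↥(ctrs P) => roww δ₂ n (dstar n μ (B6Eq250.aTerm (hDiag ℓ k Mh P) (gPad ℓ k Mh P aj a m2 Λ hP) q)) x)
    (fun q => q.1) Subtype.val_injective (near ((ℓ + 1) ^ k * ((ℓ + 1) * Mh)) x.1)
    (fun q hq0 => by
      refine mem_near_of_abs_lt hN1 fun ν => ?_
      have h0 : hΩ ℓ k Mh P q.1 x ≠ 0 := by
        intro h0
        exact hq0 (le_antisymm ((hterm q).trans (by rw [h0, abs_zero, zero_mul])) (roww_nonneg _ _ _ _))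
      have hNr : (0 : ℝ) < (((ℓ + 1) ^ k * ((ℓ + 1) * Mh) : ℕ) : ℝ) := by exact_mod_cast hN1
      exact (abs_lt_of_hq_ne_zero hN1 h0 ν).trans (by nlinarith))
    hB0 hterm'
  refine key.trans ?_
  have hcard : ((near ((ℓ + 1) ^ k * ((ℓ + 1) * Mh)) x.1).card : ℝ) ≤ 2 ^ (d + 1) := by
    exact_mod_cast card_near_le _ _
  nlinarith

end GZeroAdj

/-! ## §4 The transposed (2.44): the weighted `ℓ¹` of `K(h)u` about a point, for an arbitrary `u` -/

section KCommAdjoint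

variable {N : Fin (d + 1) → ℕ}

open Literature.MathematicalPhysics.QuantumFieldTheory.Balaban1983to89.B4Reflection242 (neumannLapK diagK nbrs_comm)
open Literature.MathematicalPhysics.QuantumFieldTheory.Balaban1983to89.B4Green242Bridge (boxNbrs)
open Literature.MathematicalPhysics.QuantumFieldTheory.Balaban1983to89.B4Thm110ZeroBoxDeriv (wsum wsum_nonneg
  wsum_add_le wsum_mul_left wsum_row)

/-- the Neumann Laplacian kernel of the box is symmetric. [folklore] -/
private theorem neumannLapK_comm (N : Fin (d + 1) → ℕ) (x y : Fin (d + 1) → ℤ) :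
    (neumannLapK N x y : ℝ) = neumannLapK N y x := by
  simp only [neumannLapK]
  by_cases hxy : x = y
  · subst hxy; rfl
  · have h1 : y ≠ x := fun h => hxy h.symm
    have hn : (y ∈ nbrs x) = (x ∈ nbrs y) := propext nbrs_comm
    simp only [hxy, h1, if_false, hn]

/-- the mass kernel is symmetric. [folklore] -/
private theorem diagK_comm (c : ℝ) (x y : Fin (d + 1) → ℤ) : (diagK c x y : ℝ) = diagK c y x := by
  simp only [diagK]
  by_cases hxy : y = x
  · rw [if_pos hxy, if_pos hxy.symm]
  · rw [if_neg hxy, if_neg (fun h => hxy h.symm)]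

/-- the averaging entries of the two-level operator are symmetric (`Λ` a union of `L`-blocks: the two-level operator is
a symmetric matrix, `B6Eq238TwoLevelBox.twoLevelOp_isSymm`). [cite: Balaban1984PropagatorsII, (2.13)–(2.14) p.225] -/
theorem vEntry_comm {n ℓ : ℕ} (hn : 1 ≤ n) (aj a : ℝ) {M' : Fin (d + 1) → ℕ}
    {Λ : Finset ↥(boxDom (fun i => (ℓ + 1) * M' i))} (hΛ : IsBlockUnion ℓ M' Λ)
    (x y : ↥(boxDom (fun i => n * ((ℓ + 1) * M' i)))) : vEntry hn ℓ aj a Λ x y = vEntry hn ℓ aj a Λ y x := by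
  have hE := (twoLevelOp_isSymm n ℓ aj a 0 M' Λ).apply x y
  rw [twoLevelOp_apply' hn aj a 0 hΛ y x, twoLevelOp_apply' hn aj a 0 hΛ x y, neumannLapK_comm _ y.1 x.1,
    diagK_comm _ y.1 x.1] at hE
  linarith

/-- a sum over the sites `w` with `w = z + e_μ`: the forward neighbour if the bond `⟨z, z + ξe_μ⟩ ⊂ Ω` exists, nothing
otherwise. [cite: Balaban1983RegularityDecay, (1.3) p.572 («bonds … with end-points b₋, b₊ in Ω»), dictionary] -/
theorem sum_ite_eq_add_single (μ : Fin (d + 1)) (z : ↥(boxDom N)) (G : ↥(boxDom N) → ℝ) :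
    ∑ w : ↥(boxDom N), (if w.1 = z.1 + Pi.single μ 1 then G w else 0)
      = if z.1 + Pi.single μ 1 ∈ boxDom N then G (fwd N μ z) else 0 := by
  by_cases hmem : z.1 + Pi.single μ 1 ∈ boxDom N
  · rw [if_pos hmem]
    have hc : ∀ w : ↥(boxDom N), (if w.1 = z.1 + Pi.single μ 1 then G w else 0)
        = (if fwd N μ z = w then G w else 0) := by
      intro w
      by_cases h1 : w.1 = z.1 + Pi.single μ 1
      · rw [if_pos h1, if_pos (fwd_eq_of_nbr μ z w h1)]
      · rw [if_neg h1, if_neg (fun h2 => h1 (by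
          rw [← h2]; exact B4Lemma22ZeroBoxDerivDual.fwd_val_of_mem μ z hmem))]
    rw [Finset.sum_congr rfl fun w _ => hc w, Finset.sum_ite_eq, if_pos (Finset.mem_univ _)]
  · rw [if_neg hmem]
    refine Finset.sum_eq_zero fun w _ => ?_
    rw [if_neg (fun h1 : w.1 = z.1 + Pi.single μ 1 => hmem (h1 ▸ w.2))]

/-- THE STAR OF A SITE IS COVERED BY ITS `2(d+1)` COORDINATE BONDS: for `F ≥ 0`,
`Σ_{w∼z, w∈□} F(w) ≤ Σ_μ (Σ_w[w = z+e_μ]F(w) + Σ_w[z = w+e_μ]F(w))` (the pattern of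
`B4Eq220CommutatorZeroBox.sum_boxNbrs_le`; the star `st(x)` of (2.40) through the bonds of (1.3)).
[cite: Balaban1983RegularityDecay, (1.3) p.572, dictionary; Balaban1984PropagatorsII, (2.40) p.230 («Σ_{b∈st(x)}»)] -/
theorem sum_boxNbrs_le' (z : ↥(boxDom N)) (F : ↥(boxDom N) → ℝ) (hF : ∀ w, 0 ≤ F w) :
    ∑ w ∈ boxNbrs N z, F w
      ≤ ∑ μ : Fin (d + 1), ((∑ w : ↥(boxDom N), if w.1 = z.1 + Pi.single μ 1 then F w else 0)
          + ∑ w : ↥(boxDom N), if z.1 = w.1 + Pi.single μ 1 then F w else 0) := by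
  have h0 : ∀ (w : ↥(boxDom N)) (ν : Fin (d + 1)),
      0 ≤ (if w.1 = z.1 + Pi.single ν 1 then F w else 0) + (if z.1 = w.1 + Pi.single ν 1 then F w else 0) :=
    fun w ν => add_nonneg (by split_ifs; exacts [hF w, le_rfl]) (by split_ifs; exacts [hF w, le_rfl])
  have hpt : ∀ w ∈ boxNbrs N z, F w ≤ ∑ μ : Fin (d + 1),
      ((if w.1 = z.1 + Pi.single μ 1 then F w else 0) + (if z.1 = w.1 + Pi.single μ 1 then F w else 0)) := by
    intro w hw
    unfold boxNbrs at hw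
    simp only [Finset.mem_filter, Finset.mem_univ, true_and] at hw
    obtain ⟨μ, hμ⟩ := mem_nbrs.1 hw
    refine le_trans ?_ (Finset.single_le_sum (fun ν _ => h0 w ν) (Finset.mem_univ μ))
    rcases hμ with hμ | hμ
    · rw [if_pos hμ]
      exact le_add_of_nonneg_right (by split_ifs; exacts [hF w, le_rfl])
    · have hμ' : z.1 = w.1 + Pi.single μ 1 := by rw [hμ, sub_add_cancel]
      rw [if_pos hμ']
      exact le_add_of_nonneg_left (by split_ifs; exacts [hF w, le_rfl])
  calc ∑ w ∈ boxNbrs N z, F w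
      ≤ ∑ w ∈ boxNbrs N z, ∑ μ : Fin (d + 1),
          ((if w.1 = z.1 + Pi.single μ 1 then F w else 0) + (if z.1 = w.1 + Pi.single μ 1 then F w else 0)) :=
        Finset.sum_le_sum hpt
    _ ≤ ∑ w : ↥(boxDom N), ∑ μ : Fin (d + 1),
          ((if w.1 = z.1 + Pi.single μ 1 then F w else 0) + (if z.1 = w.1 + Pi.single μ 1 then F w else 0)) :=
        Finset.sum_le_sum_of_subset_of_nonneg (Finset.subset_univ _)
          fun w _ _ => Finset.sum_nonneg fun ν _ => h0 w ν
    _ = ∑ μ : Fin (d + 1), ∑ w : ↥(boxDom N),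
          ((if w.1 = z.1 + Pi.single μ 1 then F w else 0) + (if z.1 = w.1 + Pi.single μ 1 then F w else 0)) :=
        Finset.sum_comm
    _ = _ := Finset.sum_congr rfl fun μ _ => Finset.sum_add_distrib

/-- **THE BOND RESUMMATION**: the weighted sum over the sites `z` of the star sums `Σ_{w∼z}|ξ^{−1}(u(w) − u(z))|` is at
most `(1 + e^{δ})` times the sum over the axes of the weighted BOND sums `Σ_z|ξ^{−1}(u(fwd_μ z) − u(z))|e^{δ|x−z|_∞/n}`
(each bond is seen from its two end-points, the far one at distance `≤ 1` more) — the resummation of the first term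
`Σ_{b∈st(x)}(∂h)(b)(∂u)(b)` of (2.40) over the sites against the exponential weight.
[cite: Balaban1984PropagatorsII, (2.40) p.230, bookkeeping] -/
theorem weighted_star_absDiff_le {δ : ℝ} (hδ : 0 ≤ δ) {n : ℕ} (hn : 1 ≤ n) (u : ↥(boxDom N) → ℝ)
    (x : ↥(boxDom N)) :
    ∑ z, Real.exp (δ * supNorm (x.1 - z.1) / n) * ∑ w ∈ boxNbrs N z, |(n : ℝ) * (u w - u z)|
      ≤ (1 + Real.exp δ) * ∑ μ, wsum δ n x (fun z => (n : ℝ) * (u (fwd N μ z) - u z)) := by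
  have hn' : (1 : ℝ) ≤ n := by exact_mod_cast hn
  set e : ↥(boxDom N) → ℝ := fun z => Real.exp (δ * supNorm (x.1 - z.1) / n) with he
  have he0 : ∀ z, 0 ≤ e z := fun z => (Real.exp_pos _).le
  -- the weight at the forward neighbour against the weight at the site
  have hefwd : ∀ (μ : Fin (d + 1)) (w : ↥(boxDom N)), e (fwd N μ w) ≤ Real.exp δ * e w := by
    intro μ w
    rw [he]
    simp only
    rw [← Real.exp_add]
    apply Real.exp_le_exp.2
    have htri := supNorm_sub_le_sub_add_sub x.1 w.1 (fwd N μ w).1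
    have h1 : supNorm (w.1 - (fwd N μ w).1) ≤ 1 := by
      rw [← B4TorusKernel.supNorm_neg, neg_sub]; exact supNorm_fwd_sub_le μ w
    have h2 : δ * supNorm (x.1 - (fwd N μ w).1) / n ≤ δ * (supNorm (x.1 - w.1) + 1) / n :=
      div_le_div_of_nonneg_right (mul_le_mul_of_nonneg_left (by linarith) hδ) (Nat.cast_nonneg n)
    have h3 : δ * (supNorm (x.1 - w.1) + 1) / n = δ * supNorm (x.1 - w.1) / n + δ / n := by ring
    have h4 : δ / n ≤ δ := div_le_self hδ hn'
    linarith
  -- the star sums through the coordinate bonds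
  have hstar : ∀ z, e z * ∑ w ∈ boxNbrs N z, |(n : ℝ) * (u w - u z)|
      ≤ ∑ μ : Fin (d + 1), (e z * (∑ w : ↥(boxDom N), if w.1 = z.1 + Pi.single μ 1 then |(n : ℝ) * (u w - u z)| else 0)
          + e z * (∑ w : ↥(boxDom N), if z.1 = w.1 + Pi.single μ 1 then |(n : ℝ) * (u w - u z)| else 0)) := by
    intro z
    have := mul_le_mul_of_nonneg_left (sum_boxNbrs_le' z (fun w => |(n : ℝ) * (u w - u z)|) fun w => abs_nonneg _)
      (he0 z)
    refine this.trans (le_of_eq ?_)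
    rw [Finset.mul_sum]
    exact Finset.sum_congr rfl fun μ _ => mul_add _ _ _
  refine (Finset.sum_le_sum fun z _ => hstar z).trans ?_
  rw [Finset.sum_comm, Finset.mul_sum]
  refine Finset.sum_le_sum fun μ _ => ?_
  rw [Finset.sum_add_distrib]
  -- forward bonds
  have hF : ∑ z, e z * (∑ w : ↥(boxDom N), if w.1 = z.1 + Pi.single μ 1 then |(n : ℝ) * (u w - u z)| else 0)
      ≤ wsum δ n x (fun z => (n : ℝ) * (u (fwd N μ z) - u z)) := by
    unfold wsum
    refine Finset.sum_le_sum fun z _ => ?_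
    rw [sum_ite_eq_add_single μ z (fun w => |(n : ℝ) * (u w - u z)|), mul_comm]
    refine mul_le_mul_of_nonneg_right ?_ (he0 z)
    split_ifs
    · exact le_rfl
    · exact abs_nonneg _
  -- backward bonds, re-indexed by the lower end-point
  have hB : ∑ z, e z * (∑ w : ↥(boxDom N), if z.1 = w.1 + Pi.single μ 1 then |(n : ℝ) * (u w - u z)| else 0)
      ≤ Real.exp δ * wsum δ n x (fun z => (n : ℝ) * (u (fwd N μ z) - u z)) := by
    calc ∑ z, e z * (∑ w : ↥(boxDom N), if z.1 = w.1 + Pi.single μ 1 then |(n : ℝ) * (u w - u z)| else 0)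
        = ∑ w : ↥(boxDom N), ∑ z : ↥(boxDom N),
            (if z.1 = w.1 + Pi.single μ 1 then e z * |(n : ℝ) * (u w - u z)| else 0) := by
          rw [Finset.sum_comm]
          refine Finset.sum_congr rfl fun z _ => ?_
          rw [Finset.mul_sum]
          exact Finset.sum_congr rfl fun w _ => by split_ifs <;> simp
      _ = ∑ w : ↥(boxDom N), (if w.1 + Pi.single μ 1 ∈ boxDom N then
            e (fwd N μ w) * |(n : ℝ) * (u w - u (fwd N μ w))| else 0) :=
          Finset.sum_congr rfl fun w _ => sum_ite_eq_add_single μ w (fun z => e z * |(n : ℝ) * (u w - u z)|)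
      _ ≤ ∑ w : ↥(boxDom N), Real.exp δ * (|(n : ℝ) * (u (fwd N μ w) - u w)| * e w) := by
          refine Finset.sum_le_sum fun w _ => ?_
          split_ifs
          · rw [show (n : ℝ) * (u w - u (fwd N μ w)) = -((n : ℝ) * (u (fwd N μ w) - u w)) by ring, abs_neg,
              mul_comm, mul_left_comm]
            exact mul_le_mul_of_nonneg_left (hefwd μ w) (abs_nonneg _)
          · positivity
      _ = Real.exp δ * wsum δ n x (fun z => (n : ℝ) * (u (fwd N μ z) - u z)) := by
          unfold wsum; rw [Finset.mul_sum]
  linarith [hF, hB]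

/-- **THE WEIGHTED `ℓ¹` OF `K(h)u` ABOUT A POINT** (the transposed (2.44), deterministic form): for the genuine two-level
operator `E` (`Λ` a union of `L`-blocks), a cut-off `h` with unit-scale Lipschitz constant `κ₁` and unit-scale Laplacian
bound `κ₂`, every `u` and every base point `x`,
`Σ_z|(K(h)u)(z)|e^{δ|x−z|_∞/n} ≤ κ₁(1+e^{δ})Σ_μΣ_z|∂^ξ_μu(z)|e^{…} + (κ₂ + (a_j+a)Le^{δL}κ₁)Σ_z|u(z)|e^{…}` — the three
terms of (2.40) (`B6Ineq243TwoLevelBox.eq240_twoLevel`) summed against the weight instead of evaluated at a point.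
[cite: Balaban1984PropagatorsII, (2.40), (2.44) p.230] -/
theorem wsum_kComm_le {n ℓ : ℕ} (hn : 1 ≤ n) {aj a m2 : ℝ} (haj : 0 < aj) (ha : 0 ≤ a)
    {M' : Fin (d + 1) → ℕ} {Λ : Finset ↥(boxDom (fun i => (ℓ + 1) * M' i))} (hΛ : IsBlockUnion ℓ M' Λ)
    {δ κ₁ κ₂ : ℝ} (hδ : 0 ≤ δ) (hκ₁ : 0 ≤ κ₁)
    (h : ↥(boxDom (fun i => n * ((ℓ + 1) * M' i))) → ℝ)
    (hLip : ∀ z z' : ↥(boxDom (fun i => n * ((ℓ + 1) * M' i))), |h z' - h z| ≤ κ₁ * supNorm (z'.1 - z.1) / n)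
    (hLap : ∀ z : ↥(boxDom (fun i => n * ((ℓ + 1) * M' i))),
      |(n : ℝ) ^ 2 * ∑ z' ∈ boxNbrs _ z, (h z' - h z)| ≤ κ₂)
    (u : ↥(boxDom (fun i => n * ((ℓ + 1) * M' i))) → ℝ) (x : ↥(boxDom (fun i => n * ((ℓ + 1) * M' i)))) :
    wsum δ n x (fun z => (kComm (twoLevelOp n ℓ aj a m2 M' Λ) h *ᵥ u) z)
      ≤ κ₁ * (1 + Real.exp δ) * ∑ μ, wsum δ n x (fun z => (n : ℝ) * (u (fwd _ μ z) - u z))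
        + (κ₂ + (aj + a) * ((ℓ : ℝ) + 1) * Real.exp (δ * ((ℓ : ℝ) + 1)) * κ₁) * wsum δ n x u := by
  have hn' : (0 : ℝ) < n := by exact_mod_cast hn
  have hn1 : (1 : ℝ) ≤ n := by exact_mod_cast hn
  have hL0 : (0 : ℝ) ≤ (ℓ : ℝ) + 1 := by positivity
  set e : ↥(boxDom (fun i => n * ((ℓ + 1) * M' i))) → ℝ := fun z => Real.exp (δ * supNorm (x.1 - z.1) / n) with he
  have he0 : ∀ z, 0 ≤ e z := fun z => (Real.exp_pos _).le
  -- (2.40) at every point, in absolute value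
  have hpt : ∀ z, |(kComm (twoLevelOp n ℓ aj a m2 M' Λ) h *ᵥ u) z|
      ≤ κ₁ * ∑ w ∈ boxNbrs _ z, |(n : ℝ) * (u w - u z)| + κ₂ * |u z|
        + κ₁ * ((ℓ : ℝ) + 1) * ∑ w, vEntry hn ℓ aj a Λ z w * |u w| := by
    intro z
    rw [eq240_twoLevel hn aj a m2 hΛ h u z]
    refine (abs_add_le _ _).trans (add_le_add ((abs_add_le _ _).trans (add_le_add ?_ ?_)) ?_)
    · refine (Finset.abs_sum_le_sum_abs _ _).trans ?_
      rw [Finset.mul_sum]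
      refine Finset.sum_le_sum fun w hw => ?_
      rw [abs_mul]
      refine mul_le_mul_of_nonneg_right ?_ (abs_nonneg _)
      rw [abs_mul, abs_of_nonneg hn'.le]
      have h1 := hLip z w
      have h2 := supNorm_sub_le_one_of_mem_boxNbrs hw
      calc (n : ℝ) * |h w - h z| ≤ (n : ℝ) * (κ₁ * supNorm (w.1 - z.1) / n) := mul_le_mul_of_nonneg_left h1 hn'.le
        _ = κ₁ * supNorm (w.1 - z.1) := by field_simp
        _ ≤ κ₁ * 1 := mul_le_mul_of_nonneg_left h2 hκ₁
        _ = κ₁ := mul_one _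
    · rw [abs_mul, mul_comm]
      exact mul_le_mul_of_nonneg_right (hLap z) (abs_nonneg _)
    · refine (Finset.abs_sum_le_sum_abs _ _).trans ?_
      rw [Finset.mul_sum]
      refine Finset.sum_le_sum fun w _ => ?_
      have hv0 := vEntry_nonneg hn ℓ haj ha Λ z w
      rw [abs_mul, abs_mul, abs_of_nonneg hv0]
      by_cases hv : vEntry hn ℓ aj a Λ z w = 0
      · rw [hv]; simp
      · have hd := supNorm_le_of_vEntry_ne_zero hn ℓ aj a Λ hv
        have h1 := hLip w z
        have hh : |h z - h w| ≤ κ₁ * ((ℓ : ℝ) + 1) := by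
          calc |h z - h w| ≤ κ₁ * supNorm (z.1 - w.1) / n := h1
            _ ≤ κ₁ * ((n : ℝ) * ((ℓ : ℝ) + 1)) / n :=
                div_le_div_of_nonneg_right (mul_le_mul_of_nonneg_left hd hκ₁) hn'.le
            _ = κ₁ * ((ℓ : ℝ) + 1) := by field_simp
        calc vEntry hn ℓ aj a Λ z w * |h z - h w| * |u w|
            ≤ vEntry hn ℓ aj a Λ z w * (κ₁ * ((ℓ : ℝ) + 1)) * |u w| :=
              mul_le_mul_of_nonneg_right (mul_le_mul_of_nonneg_left hh hv0) (abs_nonneg _)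
          _ = κ₁ * ((ℓ : ℝ) + 1) * (vEntry hn ℓ aj a Λ z w * |u w|) := by ring
  -- the column sums of the averaging part against the weight
  have hcol : ∀ w, ∑ z, vEntry hn ℓ aj a Λ z w * e z ≤ (aj + a) * Real.exp (δ * ((ℓ : ℝ) + 1)) * e w := by
    intro w
    have hz : ∀ z, vEntry hn ℓ aj a Λ z w * e z ≤ vEntry hn ℓ aj a Λ w z * (Real.exp (δ * ((ℓ : ℝ) + 1)) * e w) := by
      intro z
      rw [vEntry_comm hn aj a hΛ z w]
      by_cases hv : vEntry hn ℓ aj a Λ w z = 0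
      · rw [hv, zero_mul, zero_mul]
      · refine mul_le_mul_of_nonneg_left ?_ (vEntry_nonneg hn ℓ haj ha Λ w z)
        have hd := supNorm_le_of_vEntry_ne_zero hn ℓ aj a Λ hv
        rw [he]
        simp only
        rw [← Real.exp_add]
        apply Real.exp_le_exp.2
        have htri := supNorm_sub_le_sub_add_sub x.1 w.1 z.1
        have h2 : δ * supNorm (x.1 - z.1) / n ≤ δ * (supNorm (x.1 - w.1) + (n : ℝ) * ((ℓ : ℝ) + 1)) / n :=
          div_le_div_of_nonneg_right (mul_le_mul_of_nonneg_left (by linarith) hδ) hn'.le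
        have h3 : δ * (supNorm (x.1 - w.1) + (n : ℝ) * ((ℓ : ℝ) + 1)) / n
            = δ * ((ℓ : ℝ) + 1) + δ * supNorm (x.1 - w.1) / n := by field_simp; ring
        linarith
    refine (Finset.sum_le_sum fun z _ => hz z).trans ?_
    rw [← Finset.sum_mul, mul_assoc (aj + a)]
    exact mul_le_mul_of_nonneg_right (sum_vEntry_le hn haj ha Λ w) (mul_nonneg (Real.exp_pos _).le (he0 w))
  -- summing (2.40) against the weight
  have hsum : wsum δ n x (fun z => (kComm (twoLevelOp n ℓ aj a m2 M' Λ) h *ᵥ u) z)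
      ≤ κ₁ * ∑ z, e z * ∑ w ∈ boxNbrs _ z, |(n : ℝ) * (u w - u z)| + κ₂ * wsum δ n x u
        + κ₁ * ((ℓ : ℝ) + 1) * ∑ z, e z * ∑ w, vEntry hn ℓ aj a Λ z w * |u w| := by
    unfold wsum
    rw [Finset.mul_sum, Finset.mul_sum, Finset.mul_sum, ← Finset.sum_add_distrib, ← Finset.sum_add_distrib]
    refine Finset.sum_le_sum fun z _ => ?_
    have := mul_le_mul_of_nonneg_right (hpt z) (he0 z)
    refine this.trans (le_of_eq ?_)
    rw [he]
    ring
  refine hsum.trans ?_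
  have h1 := mul_le_mul_of_nonneg_left (weighted_star_absDiff_le (N := fun i => n * ((ℓ + 1) * M' i)) hδ hn u x) hκ₁
  have h3 : ∑ z, e z * ∑ w, vEntry hn ℓ aj a Λ z w * |u w|
      ≤ (aj + a) * Real.exp (δ * ((ℓ : ℝ) + 1)) * wsum δ n x u := by
    calc ∑ z, e z * ∑ w, vEntry hn ℓ aj a Λ z w * |u w|
        = ∑ w, |u w| * ∑ z, vEntry hn ℓ aj a Λ z w * e z := by
          simp_rw [Finset.mul_sum]
          rw [Finset.sum_comm]
          exact Finset.sum_congr rfl fun w _ => Finset.sum_congr rfl fun z _ => by ring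
      _ ≤ ∑ w, |u w| * ((aj + a) * Real.exp (δ * ((ℓ : ℝ) + 1)) * e w) :=
          Finset.sum_le_sum fun w _ => mul_le_mul_of_nonneg_left (hcol w) (abs_nonneg _)
      _ = (aj + a) * Real.exp (δ * ((ℓ : ℝ) + 1)) * wsum δ n x u := by
          unfold wsum; rw [Finset.mul_sum]
          exact Finset.sum_congr rfl fun w _ => by rw [he]; ring
  have h3' := mul_le_mul_of_nonneg_left h3 (mul_nonneg hκ₁ hL0)
  have e1 : κ₁ * ((1 + Real.exp δ) * ∑ μ, wsum δ n x (fun z => (n : ℝ) * (u (fwd _ μ z) - u z)))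
      = κ₁ * (1 + Real.exp δ) * ∑ μ, wsum δ n x (fun z => (n : ℝ) * (u (fwd _ μ z) - u z)) := by ring
  have e2 : κ₁ * ((ℓ : ℝ) + 1) * ((aj + a) * Real.exp (δ * ((ℓ : ℝ) + 1)) * wsum δ n x u)
      = (aj + a) * ((ℓ : ℝ) + 1) * Real.exp (δ * ((ℓ : ℝ) + 1)) * κ₁ * wsum δ n x u := by ring
  rw [e1] at h1
  rw [e2] at h3'
  nlinarith [h1, h3', wsum_nonneg δ n x u]

end KCommAdjoint

/-! ## §5 The transposed (2.49)/(2.51): the weighted COLUMNS of `R` are `O(M^{−1})` -/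

section ColumnR

variable {ℓ k Mh : ℕ} {P : Fin (d + 1) → ℕ}

open Literature.MathematicalPhysics.QuantumFieldTheory.Balaban1983to89.B4Green242Bridge (boxNbrs)
open Literature.MathematicalPhysics.QuantumFieldTheory.Balaban1983to89.B4PartitionUnity22 (D2 D2_nonneg)
open Literature.MathematicalPhysics.QuantumFieldTheory.Balaban1983to89.B4Thm110ZeroBoxDeriv (wsum wsum_nonneg wsum_row)

/-- `n·L·M_h ≥ 4` for `L ≥ 2`, `k, M_h ≥ 1` (the face lemmas of `B6Partition236TwoLevelBox` need it). [folklore] -/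
private theorem four_le_N' (hℓ : 1 ≤ ℓ) (hk : 1 ≤ k) (hMh : 1 ≤ Mh) : 4 ≤ (ℓ + 1) ^ k * ((ℓ + 1) * Mh) := by
  have h2 : 2 ≤ (ℓ + 1) ^ k := by
    calc 2 = 2 ^ 1 := by norm_num
      _ ≤ (ℓ + 1) ^ 1 := Nat.pow_le_pow_left (by omega) 1
      _ ≤ (ℓ + 1) ^ k := Nat.pow_le_pow_right (by omega) hk
  have : 2 ≤ (ℓ + 1) * Mh := by nlinarith
  nlinarith

variable {N : Fin (d + 1) → ℕ} in
/-- `K(h)ᵀ = −K(h)` for a symmetric `E` (`K(h) = hE − Eh`). [cite: Balaban1984PropagatorsII, (2.38)–(2.39) p.229] -/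
theorem kComm_transpose (E : Matrix ↥(boxDom N) ↥(boxDom N) ℝ) (hE : E.IsSymm) (h : ↥(boxDom N) → ℝ) :
    (kComm E h)ᵀ = -kComm E h := by
  unfold kComm
  rw [Matrix.transpose_sub, Matrix.transpose_mul, Matrix.transpose_mul, Matrix.diagonal_transpose, hE.eq, neg_sub]

variable {N : Fin (d + 1) → ℕ} in
/-- the row `a` of `G·K(h)` is `−K(h)` applied to the row `a` of `G` (`E` symmetric): `(GK(h))(a,z) = −(K(h)G(a,·))(z)`.
[cite: Balaban1984PropagatorsII, (2.38)–(2.40) pp.229–230, dictionary] -/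
theorem mul_kComm_apply (E G : Matrix ↥(boxDom N) ↥(boxDom N) ℝ) (hE : E.IsSymm) (h : ↥(boxDom N) → ℝ)
    (a z : ↥(boxDom N)) : (G * kComm E h) a z = -((kComm E h *ᵥ (fun w => G a w)) z) := by
  rw [Matrix.mul_apply, kComm_mulVec, ← Finset.sum_neg_distrib]
  refine Finset.sum_congr rfl fun w _ => ?_
  rw [kComm_apply, hE.apply w z]
  ring

variable {N : Fin (d + 1) → ℕ} in
/-- hence the weighted row `a` of `G·K(h)` is the weighted `ℓ¹` about `a` of `K(h)` applied to the row `a` of `G`.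
[cite: Balaban1984PropagatorsII, (2.38)–(2.40) pp.229–230, dictionary] -/
theorem roww_mul_kComm (δ : ℝ) (n : ℕ) (E G : Matrix ↥(boxDom N) ↥(boxDom N) ℝ) (hE : E.IsSymm)
    (h : ↥(boxDom N) → ℝ) (a : ↥(boxDom N)) :
    roww δ n (G * kComm E h) a = wsum δ n a (fun z => (kComm E h *ᵥ (fun w => G a w)) z) := by
  unfold roww wsum
  exact Finset.sum_congr rfl fun z _ => by rw [mul_kComm_apply E G hE h a z, abs_neg]

/-- **«∂h = O(M^{−1})» FOR THE CUT-OFF SEEN FROM ITS CUBE**: `|h_q(z′) − h_q(z)| ≤ ((d+1)sup|h′|/M)·|z′ − z|_∞/n`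
(`B6Partition236TwoLevelBox.abs_hq_sub_le`). [cite: Balaban1984PropagatorsII, (2.40)/(2.44) p.230] -/
theorem hLoc_lipschitz (hMh : 1 ≤ Mh) (q : Fin (d + 1) → ℤ)
    (z z' : ↥(Box d ℓ k (fun i => (ℓ + 1) * cubeM' Mh P q i))) :
    |hLoc ℓ k Mh P q z' - hLoc ℓ k Mh P q z|
      ≤ (d + 1) * D1 hprof / (((ℓ : ℝ) + 1) * Mh) * supNorm (z'.1 - z.1) / (((ℓ + 1) ^ k : ℕ) : ℝ) := by
  have hn1 : 1 ≤ (ℓ + 1) ^ k := Nat.one_le_pow _ _ (by omega)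
  have := abs_hq_sub_le (d := d) hn1 (Nat.one_le_iff_ne_zero.2 (by positivity : (ℓ + 1) * Mh ≠ 0)) (locLabel q)
    z.1 z'.1
  unfold hLoc
  push_cast at this ⊢
  exact this

/-- **«Δh = O(M^{−2})» FOR THE CUT-OFF SEEN FROM ITS CUBE** (faces included): `|n²Σ_{z′∼z}(h_q(z′) − h_q(z))| ≤
(d+1)sup|h″|/M²` (`B6Partition236TwoLevelBox.hloc_laplacian`). [cite: Balaban1984PropagatorsII, (2.40)/(2.44) p.230] -/
theorem hLoc_laplacian_le (hℓ : 1 ≤ ℓ) (hk : 1 ≤ k) (hMh : 1 ≤ Mh) (hP : ∀ i, 1 ≤ P i) {q : Fin (d + 1) → ℤ}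
    (hq : q ∈ ctrs P) (z : ↥(Box d ℓ k (fun i => (ℓ + 1) * cubeM' Mh P q i))) :
    |((((ℓ + 1) ^ k : ℕ) : ℝ)) ^ 2 * ∑ z' ∈ boxNbrs _ z, (hLoc ℓ k Mh P q z' - hLoc ℓ k Mh P q z)|
      ≤ (d + 1) * (D2 hprof / (((ℓ : ℝ) + 1) * Mh) ^ 2) := by
  have hN4 : 4 ≤ (ℓ + 1) ^ k * ((ℓ + 1) * Mh) := four_le_N' hℓ hk hMh
  obtain hcw := fun i => cubeW_cases hP hq i
  have hl := hloc_laplacian (d := d) (n := (ℓ + 1) ^ k) (M := (ℓ + 1) * Mh) hN4 (c := locLabel q)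
    (w := fun i => cubeW P q i) (S := fun i => (ℓ + 1) ^ k * ((ℓ + 1) * cubeM' Mh P q i))
    (fun i => by simp only [cubeM']; ring) (fun i => (hcw i).1) (fun i => (hcw i).2) z
  rw [abs_mul, abs_of_nonneg (by positivity)]
  have hNsq : ((((ℓ + 1) ^ k : ℕ) : ℝ)) ^ 2 * ((d + 1) * (D2 hprof / ((((ℓ + 1) ^ k * ((ℓ + 1) * Mh) : ℕ) : ℝ)) ^ 2))
      = (d + 1) * (D2 hprof / (((ℓ : ℝ) + 1) * Mh) ^ 2) := by
    push_cast
    have : (((ℓ : ℝ) + 1) ^ k) ≠ 0 := by positivity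
    have : ((ℓ : ℝ) + 1) * Mh ≠ 0 := by
      have : (1 : ℝ) ≤ Mh := by exact_mod_cast hMh
      positivity
    field_simp
  calc ((((ℓ + 1) ^ k : ℕ) : ℝ)) ^ 2 * |∑ z' ∈ boxNbrs _ z, (hLoc ℓ k Mh P q z' - hLoc ℓ k Mh P q z)|
      ≤ ((((ℓ + 1) ^ k : ℕ) : ℝ)) ^ 2 * ((d + 1) * (D2 hprof / ((((ℓ + 1) ^ k * ((ℓ + 1) * Mh) : ℕ) : ℝ)) ^ 2)) :=
        mul_le_mul_of_nonneg_left hl (by positivity)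
    _ = _ := hNsq

/-- **ONE TERM OF `Rᵀ`**: the weighted row at `x` of `(resᵀ·K_q(h_q)G′(□_q)h_q·res)ᵀ` is at most
`|h_q(x)|·[κ₁(1+e^{δ})((d+1)c_∂) + (κ₂ + (a_j+a)Le^{δL}κ₁)c′]`, given the weighted rows `c′` of `G′(□_q)`, the weighted
bond sums `c_∂` of `G′(□_q)∂^*_μ` (all axes, all sites) and the sizes `κ₁`, `κ₂` of `h_q` — by `K(h)ᵀ = −K(h)`, the
symmetry of `G′(□_q)` and `wsum_kComm_le`. [cite: Balaban1984PropagatorsII, (2.38) p.229, (2.40)/(2.44) p.230] -/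
theorem roww_transpose_bPad_le (hℓ : 1 ≤ ℓ) (hMh : 1 ≤ Mh) (hP : ∀ i, 1 ≤ P i) {aj a m2 : ℝ}
    (haj : 0 < aj) (ha : 0 ≤ a) {Λ : Finset ↥(boxDom (fun i => (ℓ + 1) * (Mh * P i)))}
    (hΛ : IsBlockUnion ℓ (fun i => Mh * P i) Λ) (q : ↥(ctrs P)) {δ c' cs κ₁ κ₂ : ℝ} (hδ : 0 ≤ δ)
    (hc' : 0 ≤ c') (hcs : 0 ≤ cs) (hκ₁ : 0 ≤ κ₁) (hκ₂ : 0 ≤ κ₂)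
    (hG : ∀ b, roww δ ((ℓ + 1) ^ k) (cubeG ℓ k Mh P aj a m2 Λ hP q) b ≤ c')
    (hGD : ∀ (μ : Fin (d + 1)) b, roww δ ((ℓ + 1) ^ k) (dstar ((ℓ + 1) ^ k) μ (cubeG ℓ k Mh P aj a m2 Λ hP q)) b ≤ cs)
    (hLip : ∀ z z' : ↥(Box d ℓ k (fun i => (ℓ + 1) * cubeM' Mh P q.1 i)),
      |hLoc ℓ k Mh P q.1 z' - hLoc ℓ k Mh P q.1 z| ≤ κ₁ * supNorm (z'.1 - z.1) / (((ℓ + 1) ^ k : ℕ) : ℝ))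
    (hLap : ∀ z : ↥(Box d ℓ k (fun i => (ℓ + 1) * cubeM' Mh P q.1 i)),
      |((((ℓ + 1) ^ k : ℕ) : ℝ)) ^ 2 * ∑ z' ∈ boxNbrs _ z, (hLoc ℓ k Mh P q.1 z' - hLoc ℓ k Mh P q.1 z)| ≤ κ₂)
    (x : ↥(Box d ℓ k (fun i => (ℓ + 1) * (Mh * P i)))) :
    roww δ ((ℓ + 1) ^ k) (bPad ℓ k Mh P aj a m2 Λ hP q)ᵀ x
      ≤ |hΩ ℓ k Mh P q.1 x| * (κ₁ * (1 + Real.exp δ) * ((d + 1) * cs)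
          + (κ₂ + (aj + a) * ((ℓ : ℝ) + 1) * Real.exp (δ * ((ℓ : ℝ) + 1)) * κ₁) * c') := by
  have hn1 : 1 ≤ (ℓ + 1) ^ k := Nat.one_le_pow _ _ (by omega)
  have hinj := emb_injective (ℓ := ℓ) (k := k) (Mh := Mh) hP q.2
  have hEs : (cubeOp ℓ k Mh P aj a m2 Λ hP q).IsSymm := twoLevelOp_isSymm _ _ _ _ _ _ _
  have hGs : (cubeG ℓ k Mh P aj a m2 Λ hP q)ᵀ = cubeG ℓ k Mh P aj a m2 Λ hP q := (gTwoLevel_isSymm _ _ _ _ _ _ _).eq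
  have hKs : (kComm (cubeOp ℓ k Mh P aj a m2 Λ hP q) (hLoc ℓ k Mh P q.1))ᵀ
      = -kComm (cubeOp ℓ k Mh P aj a m2 Λ hP q) (hLoc ℓ k Mh P q.1) := kComm_transpose _ hEs _
  have hB0 : 0 ≤ κ₁ * (1 + Real.exp δ) * ((d + 1) * cs)
      + (κ₂ + (aj + a) * ((ℓ : ℝ) + 1) * Real.exp (δ * ((ℓ : ℝ) + 1)) * κ₁) * c' := by positivity
  -- the transpose of the padded operator
  have hT : (bPad ℓ k Mh P aj a m2 Λ hP q)ᵀ
      = -((res (emb ℓ k Mh P q.1 hP q.2))ᵀ * (Matrix.diagonal (hLoc ℓ k Mh P q.1)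
          * (cubeG ℓ k Mh P aj a m2 Λ hP q * kComm (cubeOp ℓ k Mh P aj a m2 Λ hP q) (hLoc ℓ k Mh P q.1)))
          * res (emb ℓ k Mh P q.1 hP q.2)) := by
    unfold bPad
    rw [Matrix.transpose_mul, Matrix.transpose_mul, Matrix.transpose_transpose, Matrix.transpose_mul,
      Matrix.transpose_mul, Matrix.diagonal_transpose, hGs, hKs]
    simp only [Matrix.mul_neg, Matrix.neg_mul, Matrix.mul_assoc]
  rw [hT, roww_neg]
  by_cases hx : ∃ a', emb ℓ k Mh P q.1 hP q.2 a' = x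
  · obtain ⟨a', rfl⟩ := hx
    rw [roww_pad_emb hP q.2, roww_diagonal_mul, roww_mul_kComm _ _ _ _ hEs _ a', ← hΩ_emb hMh hP q.2]
    refine mul_le_mul_of_nonneg_left ?_ (abs_nonneg _)
    have hK := wsum_kComm_le hn1 haj ha (m2 := m2) (isBlockUnion_lamLoc hP q.2 hΛ) hδ hκ₁
      (hLoc ℓ k Mh P q.1) hLip hLap (fun w => cubeG ℓ k Mh P aj a m2 Λ hP q a' w) a'
    have hsumGD : ∑ μ : Fin (d + 1), wsum δ ((ℓ + 1) ^ k) a' (fun z => ((((ℓ + 1) ^ k : ℕ)) : ℝ)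
        * (cubeG ℓ k Mh P aj a m2 Λ hP q a' (fwd _ μ z) - cubeG ℓ k Mh P aj a m2 Λ hP q a' z)) ≤ (d + 1) * cs := by
      calc ∑ μ : Fin (d + 1), wsum δ ((ℓ + 1) ^ k) a' (fun z => ((((ℓ + 1) ^ k : ℕ)) : ℝ)
            * (cubeG ℓ k Mh P aj a m2 Λ hP q a' (fwd _ μ z) - cubeG ℓ k Mh P aj a m2 Λ hP q a' z))
          ≤ ∑ _μ : Fin (d + 1), cs := Finset.sum_le_sum fun μ _ => by
            have := hGD μ a'
            rw [roww_dstar] at this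
            exact this
        _ = (d + 1) * cs := by
            rw [Finset.sum_const, Finset.card_univ, Fintype.card_fin, nsmul_eq_mul]; push_cast; ring
    have hG0 : wsum δ ((ℓ + 1) ^ k) a' (fun w => cubeG ℓ k Mh P aj a m2 Λ hP q a' w) ≤ c' := hG a'
    have hco : 0 ≤ κ₂ + (aj + a) * ((ℓ : ℝ) + 1) * Real.exp (δ * ((ℓ : ℝ) + 1)) * κ₁ := by positivity
    have t1 := mul_le_mul_of_nonneg_left hsumGD (mul_nonneg hκ₁ (by positivity : (0 : ℝ) ≤ 1 + Real.exp δ))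
    have t2 := mul_le_mul_of_nonneg_left hG0 hco
    exact hK.trans (add_le_add t1 t2)
  · push Not at hx
    rw [roww_pad_off hP q.2 _ _ _ hx]
    positivity

/-- **THE TRANSPOSED (2.49)/(2.51): THE WEIGHTED COLUMNS OF `R` ARE `O(M^{−1})`.**  There are `δ₃, C_R > 0` (functions of
`d`, `ℓ`, window) such that for EVERY mesh `k ≥ 1`, `M_h ≥ 3`, volume `P`, block union `Λ`, window point and site `x`:
`Σ_z|R(z, x)|e^{δ₃|z−x|_∞/n} ≤ C_R/M` (`M = L·M_h`), `R = Σ_q K(h_q)G′(□_q)h_q` — i.e. `R` is small on the weighted `ℓ¹`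
as well as on `ℓ^∞` ((2.49), `B6Ineq249TwoLevelBox.norm_rOp_le`).  Route: `Rᵀ = −Σ_q resᵀ·h_qG′(□_q)K_q(h_q)·res`
(`E`, `G′(□_q)` symmetric, `K(h)ᵀ = −K(h)`), the row `a` of `G′(□_q)K_q(h_q)` is `−K_q(h_q)` applied to the row `a` of
`G′(□_q)` (`roww_mul_kComm`), the weighted `ℓ¹` of `K(h)u` (`wsum_kComm_le`, the three terms of (2.40)) with the bond
sums of `G′(□_q)∂^*` (`B6Ineq243AdjTwoLevelBox.ineq243_twoLevel_dstar_roww`) and the rows of `G′(□_q)` ((2.43)₁), the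
sizes `κ₁ = (d+1)sup|h′|/M`, `κ₂ = (d+1)sup|h″|/M²` of the printed cut-off and the finite overlap.
[cite: Balaban1984PropagatorsII, (2.44) p.230, (2.49)/(2.51) p.232] -/
theorem roww_transpose_rOp_le (d ℓ : ℕ) (hℓ : 1 ≤ ℓ) (aminus aplus m2plus a2minus a2plus : ℝ) (ha : 0 < aminus)
    (ha2 : 0 < a2minus) :
    ∃ δ₃ CR : ℝ, 0 < δ₃ ∧ 0 < CR ∧ ∀ (k : ℕ), 1 ≤ k → ∀ (aj m2 a : ℝ), aminus ≤ aj → aj ≤ aplus → 0 ≤ m2 →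
      m2 ≤ m2plus → a2minus ≤ a → a ≤ a2plus → ∀ (Mh : ℕ), 3 ≤ Mh → ∀ (P : Fin (d + 1) → ℕ) (hP : ∀ i, 1 ≤ P i)
        (Λ : Finset ↥(boxDom (fun i => (ℓ + 1) * (Mh * P i)))), IsBlockUnion ℓ (fun i => Mh * P i) Λ →
        ∀ x : ↥(Box d ℓ k (fun i => (ℓ + 1) * (Mh * P i))),
          roww δ₃ ((ℓ + 1) ^ k) (B6Eq250.rOp (twoLevelOp ((ℓ + 1) ^ k) ℓ aj a m2 (fun i => Mh * P i) Λ)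
            (hDiag ℓ k Mh P) (gPad ℓ k Mh P aj a m2 Λ hP))ᵀ x ≤ CR / (((ℓ : ℝ) + 1) * Mh) := by
  obtain ⟨δa, c', hδa, hc', h243⟩ := ineq243_twoLevel_roww d ℓ hℓ aminus aplus m2plus a2minus a2plus ha ha2
  obtain ⟨δb, cs, hδb, hcs, h243s⟩ := ineq243_twoLevel_dstar_roww d ℓ hℓ aminus aplus m2plus a2minus a2plus ha ha2
  have hD1 := D1_nonneg contDiff_hprof hasCompactSupport_hprof
  have hD2 := D2_nonneg contDiff_hprof hasCompactSupport_hprof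
  obtain ⟨δ₃, hδ₃⟩ : ∃ δ₃ : ℝ, δ₃ = min δa δb := ⟨_, rfl⟩
  have hδ₃0 : 0 < δ₃ := by rw [hδ₃]; exact lt_min hδa hδb
  have hδ₃a : δ₃ ≤ δa := by rw [hδ₃]; exact min_le_left _ _
  have hδ₃b : δ₃ ≤ δb := by rw [hδ₃]; exact min_le_right _ _
  have hL0 : (0 : ℝ) ≤ (ℓ : ℝ) + 1 := by positivity
  -- the `M`-free constants
  obtain ⟨A₁, hA₁⟩ : ∃ A₁ : ℝ, A₁ = (d + 1) * D1 hprof := ⟨_, rfl⟩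
  obtain ⟨A₂, hA₂⟩ : ∃ A₂ : ℝ, A₂ = (d + 1) * D2 hprof := ⟨_, rfl⟩
  obtain ⟨c₁', hc₁'⟩ : ∃ c₁' : ℝ, c₁' = (1 + Real.exp δ₃) * ((d + 1) * cs) := ⟨_, rfl⟩
  obtain ⟨ap, hap⟩ : ∃ ap : ℝ, ap = (|aplus| + |a2plus|) * ((ℓ : ℝ) + 1) * Real.exp (δ₃ * ((ℓ : ℝ) + 1)) :=
    ⟨_, rfl⟩
  have hA₁0 : 0 ≤ A₁ := by rw [hA₁]; positivity
  have hA₂0 : 0 ≤ A₂ := by rw [hA₂]; positivity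
  have hc₁'0 : 0 ≤ c₁' := by rw [hc₁']; positivity
  have hap0 : 0 ≤ ap := by rw [hap]; positivity
  obtain ⟨CR₀, hCR₀⟩ : ∃ CR₀ : ℝ, CR₀ = A₁ * c₁' + (A₂ + ap * A₁) * c' := ⟨_, rfl⟩
  have hCR₀0 : 0 ≤ CR₀ := by rw [hCR₀]; positivity
  refine ⟨δ₃, 2 ^ (d + 1) * CR₀ + 1, hδ₃0, by positivity, ?_⟩
  intro k hk aj m2 a e1 e2 e3 e4 e5 e6 Mh hMh P hP Λ hΛ x
  have hMh1 : 1 ≤ Mh := le_trans (by norm_num) hMh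
  have hN1 : 1 ≤ (ℓ + 1) ^ k * ((ℓ + 1) * Mh) := Nat.one_le_iff_ne_zero.2 (by positivity)
  have haj : 0 < aj := lt_of_lt_of_le ha e1
  have ha0 : 0 ≤ a := (lt_of_lt_of_le ha2 e5).le
  obtain ⟨M, hM⟩ : ∃ M : ℝ, M = ((ℓ : ℝ) + 1) * Mh := ⟨_, rfl⟩
  have hM1 : (1 : ℝ) ≤ M := by
    have : (1 : ℝ) ≤ Mh := by exact_mod_cast hMh1
    have : (1 : ℝ) ≤ (ℓ : ℝ) + 1 := by linarith [(Nat.cast_nonneg ℓ : (0 : ℝ) ≤ ℓ)]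
    rw [hM]; nlinarith
  have hMpos : 0 < M := by linarith
  rw [← hM]
  obtain ⟨κ₁, hκ₁⟩ : ∃ κ₁ : ℝ, κ₁ = A₁ / M := ⟨_, rfl⟩
  obtain ⟨κ₂, hκ₂⟩ : ∃ κ₂ : ℝ, κ₂ = (d + 1) * (D2 hprof / M ^ 2) := ⟨_, rfl⟩
  have hκ₁0 : 0 ≤ κ₁ := by rw [hκ₁]; positivity
  have hκ₂0 : 0 ≤ κ₂ := by rw [hκ₂]; positivity
  have hM' : ∀ q : ↥(ctrs P), ∀ i, 1 ≤ cubeM' Mh P q.1 i := fun q i =>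
    Nat.one_le_iff_ne_zero.2 (Nat.mul_ne_zero_iff.2 ⟨by omega, by have := (one_le_cubeW hP q.2 i).1; omega⟩)
  -- the per-cube constant and its size
  obtain ⟨BM, hBM⟩ : ∃ BM : ℝ, BM = κ₁ * (1 + Real.exp δ₃) * ((d + 1) * cs)
      + (κ₂ + (aj + a) * ((ℓ : ℝ) + 1) * Real.exp (δ₃ * ((ℓ : ℝ) + 1)) * κ₁) * c' := ⟨_, rfl⟩
  have hBM0 : 0 ≤ BM := by rw [hBM]; positivity
  have hBMle : BM ≤ CR₀ / M := by
    have hκ₂' : κ₂ ≤ A₂ / M := by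
      rw [hκ₂, hA₂]
      have hM2 : D2 hprof / M ^ 2 ≤ D2 hprof / M := by
        apply div_le_div_of_nonneg_left hD2 hMpos
        calc M = M * 1 := (mul_one M).symm
          _ ≤ M * M := mul_le_mul_of_nonneg_left hM1 hMpos.le
          _ = M ^ 2 := (sq M).symm
      calc ((d : ℝ) + 1) * (D2 hprof / M ^ 2) ≤ (d + 1) * (D2 hprof / M) :=
            mul_le_mul_of_nonneg_left hM2 (by positivity)
        _ = (d + 1) * D2 hprof / M := mul_div_assoc' _ _ _
    have hajp : (aj + a) * ((ℓ : ℝ) + 1) * Real.exp (δ₃ * ((ℓ : ℝ) + 1)) ≤ ap := by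
      rw [hap]
      have : aj + a ≤ |aplus| + |a2plus| := add_le_add (e2.trans (le_abs_self _)) (e6.trans (le_abs_self _))
      exact mul_le_mul_of_nonneg_right (mul_le_mul_of_nonneg_right this hL0) (Real.exp_pos _).le
    have h1 : (κ₂ + (aj + a) * ((ℓ : ℝ) + 1) * Real.exp (δ₃ * ((ℓ : ℝ) + 1)) * κ₁) * c'
        ≤ (A₂ / M + ap * κ₁) * c' :=
      mul_le_mul_of_nonneg_right (add_le_add hκ₂' (mul_le_mul_of_nonneg_right hajp hκ₁0)) hc'.le
    have h2 : κ₁ * (1 + Real.exp δ₃) * ((d + 1) * cs) + (A₂ / M + ap * κ₁) * c' = CR₀ / M := by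
      rw [hCR₀, hκ₁, hc₁']; ring
    rw [hBM, ← h2]
    exact add_le_add le_rfl h1
  -- per-cube bound of the transposed padded (2.44)-operator
  have hterm : ∀ q : ↥(ctrs P),
      roww δ₃ ((ℓ + 1) ^ k) (bPad ℓ k Mh P aj a m2 Λ hP q)ᵀ x ≤ |hΩ ℓ k Mh P q.1 x| * BM := by
    intro q
    rw [hBM]
    refine roww_transpose_bPad_le hℓ hMh1 hP haj ha0 hΛ q hδ₃0.le hc'.le hcs.le hκ₁0 hκ₂0
      (fun b => (roww_mono hδ₃a _ _ _).trans
        (h243 k hk aj m2 a e1 e2 e3 e4 e5 e6 (cubeM' Mh P q.1) (hM' q) (lamLoc ℓ Mh P q.1 hP q.2 Λ) b))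
      (fun μ b => (roww_mono hδ₃b _ _ _).trans
        (h243s k hk aj m2 a e1 e2 e3 e4 e5 e6 (cubeM' Mh P q.1) (hM' q) (lamLoc ℓ Mh P q.1 hP q.2 Λ) μ b))
      (fun z z' => ?_) (fun z => ?_) x
    · rw [hκ₁, hA₁, hM]; exact hLoc_lipschitz hMh1 q.1 z z'
    · rw [hκ₂, hM]; exact hLoc_laplacian_le hℓ hk hMh1 hP q.2 z
  -- `Rᵀ = Σ_q (resᵀ·K_q(h_q)G′(□_q)h_q·res)ᵀ` and the overlap count
  have hb : ∀ q : ↥(ctrs P), B6Eq250.bTerm (twoLevelOp ((ℓ + 1) ^ k) ℓ aj a m2 (fun i => Mh * P i) Λ)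
      (hDiag ℓ k Mh P) (gPad ℓ k Mh P aj a m2 Λ hP) q = bPad ℓ k Mh P aj a m2 Λ hP q := fun q => by
    rw [B6Eq250.bTerm_apply]; exact bTerm_eq_bPad hℓ hk hMh1 hΛ q
  rw [B6Eq250.rOp_eq_sum_bTerm, Matrix.transpose_sum]
  simp_rw [hb]
  refine (roww_sum_le _ _ _ _ x).trans ?_
  have hterm' : ∀ q : ↥(ctrs P), roww δ₃ ((ℓ + 1) ^ k) (bPad ℓ k Mh P aj a m2 Λ hP q)ᵀ x ≤ BM := fun q =>
    (hterm q).trans (by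
      calc |hΩ ℓ k Mh P q.1 x| * BM ≤ 1 * BM := mul_le_mul_of_nonneg_right (abs_hq_le_one _ _ _ _) hBM0
        _ = BM := one_mul _)
  have key := sum_le_card_mul₃ (fun q : ↥(ctrs P) => roww δ₃ ((ℓ + 1) ^ k) (bPad ℓ k Mh P aj a m2 Λ hP q)ᵀ x)
    (fun q => q.1) Subtype.val_injective (near ((ℓ + 1) ^ k * ((ℓ + 1) * Mh)) x.1)
    (fun q hq0 => by
      refine mem_near_of_abs_lt hN1 fun ν => ?_
      have h0 : hΩ ℓ k Mh P q.1 x ≠ 0 := by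
        intro h0
        exact hq0 (le_antisymm ((hterm q).trans (by rw [h0, abs_zero, zero_mul])) (roww_nonneg _ _ _ _))
      have hNr : (0 : ℝ) < (((ℓ + 1) ^ k * ((ℓ + 1) * Mh) : ℕ) : ℝ) := by exact_mod_cast hN1
      exact (abs_lt_of_hq_ne_zero hN1 h0 ν).trans (by nlinarith))
    hBM0 hterm'
  refine key.trans ?_
  have hcard : ((near ((ℓ + 1) ^ k * ((ℓ + 1) * Mh)) x.1).card : ℝ) ≤ 2 ^ (d + 1) := by
    exact_mod_cast card_near_le _ _
  calc ((near ((ℓ + 1) ^ k * ((ℓ + 1) * Mh)) x.1).card : ℝ) * BM ≤ 2 ^ (d + 1) * BM :=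
        mul_le_mul_of_nonneg_right hcard hBM0
    _ ≤ 2 ^ (d + 1) * (CR₀ / M) := mul_le_mul_of_nonneg_left hBMle (by positivity)
    _ = (2 ^ (d + 1) * CR₀) / M := (mul_div_assoc _ _ _).symm
    _ ≤ (2 ^ (d + 1) * CR₀ + 1) / M := by gcongr; linarith

end ColumnR

/-! ## §6 (2.66) ⇒ (2.67)₃: the resummation for `G′∂^*`, `G′ = (Δ_Ω^{L^{−j},N} + m² + Q′*aQ′)^{−1}` -/

section Prop22Adj

variable {ℓ k Mh : ℕ} {P : Fin (d + 1) → ℕ}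

/-- the padded cube propagators are symmetric. [cite: Balaban1984PropagatorsII, (2.37) p.229, (2.42) p.230] -/
theorem gPad_transpose (hP : ∀ i, 1 ≤ P i) (aj a m2 : ℝ) (Λ : Finset ↥(boxDom (fun i => (ℓ + 1) * (Mh * P i))))
    (q : ↥(ctrs P)) : (gPad ℓ k Mh P aj a m2 Λ hP q)ᵀ = gPad ℓ k Mh P aj a m2 Λ hP q := by
  unfold gPad cubeG
  rw [Matrix.transpose_mul, Matrix.transpose_mul, Matrix.transpose_transpose, (gTwoLevel_isSymm _ _ _ _ _ _ _).eq,
    ← Matrix.mul_assoc]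

/-- `G′₀ = Σ_q h_qG′(□_q)h_q` is symmetric. [cite: Balaban1984PropagatorsII, (2.37) p.229] -/
theorem gZero_isSymm (hP : ∀ i, 1 ≤ P i) (aj a m2 : ℝ) (Λ : Finset ↥(boxDom (fun i => (ℓ + 1) * (Mh * P i)))) :
    (B6Eq250.gZero (hDiag ℓ k Mh P) (gPad ℓ k Mh P aj a m2 Λ hP)).IsSymm := by
  unfold Matrix.IsSymm
  rw [B6Eq250.gZero_eq_sum_aTerm, Matrix.transpose_sum]
  refine Finset.sum_congr rfl fun q _ => ?_
  rw [B6Eq250.aTerm_apply]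
  unfold hDiag
  rw [Matrix.transpose_mul, Matrix.transpose_mul, Matrix.diagonal_transpose, gPad_transpose, ← Matrix.mul_assoc]

/-- **THE TRANSPOSED FIXED-POINT FORM OF (2.38)/(2.50)**: `G′ = G′₀ + RᵀG′` (transpose `Δ′_aG′₀ = I − R` using the
symmetry of `Δ′_a` and `G′₀`, and multiply by `G′ = Δ′_a^{−1}` on the right) — the form of the resummation adapted to
COLUMN functionals. [cite: Balaban1984PropagatorsII, (2.38) p.229, (2.50) p.232] -/
theorem gTwoLevel_eq_gZero_add_transpose (hℓ : 1 ≤ ℓ) (hk : 1 ≤ k) (hMh : 1 ≤ Mh) (hP : ∀ i, 1 ≤ P i) {aj a m2 : ℝ}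
    (haj : 0 < aj) (ha : 0 < a) (hm : 0 ≤ m2) {Λ : Finset ↥(boxDom (fun i => (ℓ + 1) * (Mh * P i)))}
    (hΛ : IsBlockUnion ℓ (fun i => Mh * P i) Λ) :
    gTwoLevel ((ℓ + 1) ^ k) ℓ aj a m2 (fun i => Mh * P i) Λ
      = B6Eq250.gZero (hDiag ℓ k Mh P) (gPad ℓ k Mh P aj a m2 Λ hP)
        + (B6Eq250.rOp (twoLevelOp ((ℓ + 1) ^ k) ℓ aj a m2 (fun i => Mh * P i) Λ) (hDiag ℓ k Mh P)
            (gPad ℓ k Mh P aj a m2 Λ hP))ᵀ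
          * gTwoLevel ((ℓ + 1) ^ k) ℓ aj a m2 (fun i => Mh * P i) Λ := by
  have hn1 : 1 ≤ (ℓ + 1) ^ k := Nat.one_le_pow _ _ (by omega)
  have hEG : twoLevelOp ((ℓ + 1) ^ k) ℓ aj a m2 (fun i => Mh * P i) Λ
      * gTwoLevel ((ℓ + 1) ^ k) ℓ aj a m2 (fun i => Mh * P i) Λ = 1 :=
    twoLevelOp_mul_gTwoLevel hn1 hℓ haj ha hm
      (fun i => Nat.one_le_iff_ne_zero.2 (Nat.mul_ne_zero_iff.2 ⟨by omega, by have := hP i; omega⟩)) hΛ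
  have h238 := eq238_twoLevelBox (hP := hP) hℓ hk hMh haj ha hm hΛ
  -- transpose (2.38): `G′₀Δ′_a = I − Rᵀ`
  have h238t := congrArg Matrix.transpose h238
  rw [Matrix.transpose_mul, (twoLevelOp_isSymm _ _ _ _ _ _ _).eq, (gZero_isSymm hP aj a m2 Λ).eq,
    Matrix.transpose_sub, Matrix.transpose_one] at h238t
  have := congrArg (fun T => T * gTwoLevel ((ℓ + 1) ^ k) ℓ aj a m2 (fun i => Mh * P i) Λ) h238t
  rw [Matrix.mul_assoc, hEG, Matrix.mul_one, Matrix.sub_mul, Matrix.one_mul] at this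
  rw [this, sub_add_cancel]

/-- **[B6] PROPOSITION 2.2, THIRD ENTRY OF (2.67) (`G′∇*`, «(L^jη)² replaced by L^jη»), FOR THE GENUINE TWO-LEVEL
OPERATOR ON A BOX, ALONG THE PRINTED ROUTE**: there are `δ, M₀, C > 0` (functions of `d`, `ℓ` and the window) such
that for EVERY mesh `k ≥ 1`, `M_h ≥ 3` with `L·M_h ≥ M₀` («M sufficiently large»), volume `P`, block union `Λ`, window
point, axis `μ` and site `x ∈ Ω`: `Σ_z|ξ^{−1}(G′(x, fwd_μ z) − G′(x, z))|e^{δ|x−z|_∞/n} ≤ C` for `G′ = (Δ_Ω^{L^{−j},N} + m²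
+ Q′*aQ′)^{−1}` — the weighted bond sums of the kernel of `G′∂^{ξ*}_μ` — by the transposed fixed-point form
`G′ = G′₀ + RᵀG′` of (2.38)/(2.50) (`gTwoLevel_eq_gZero_add_transpose`, so `dstar G′ = dstar G′₀ + Rᵀ·dstar G′`), the
(2.64)-input `roww_dstar_gZero_le`, the transposed (2.51)/(2.65)-input `roww_transpose_rOp_le` (`sup roww(Rᵀ) ≤
C_R/M ≤ ½`) and the submultiplicativity/subadditivity of the weighted rows ((2.52)–(2.55), (2.66)).
[cite: Balaban1984PropagatorsII, Proposition 2.2 (2.64)–(2.67) p.234] -/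
theorem prop22_entry3_twoLevelBox (d ℓ : ℕ) (hℓ : 1 ≤ ℓ) (aminus aplus m2plus a2minus a2plus : ℝ) (ha : 0 < aminus)
    (ha2 : 0 < a2minus) :
    ∃ δ M₀ C : ℝ, 0 < δ ∧ 0 < M₀ ∧ 0 < C ∧ ∀ (k : ℕ), 1 ≤ k → ∀ (aj m2 a : ℝ), aminus ≤ aj → aj ≤ aplus → 0 ≤ m2 →
      m2 ≤ m2plus → a2minus ≤ a → a ≤ a2plus → ∀ (Mh : ℕ), 3 ≤ Mh → M₀ ≤ ((ℓ : ℝ) + 1) * Mh →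
        ∀ (P : Fin (d + 1) → ℕ), (∀ i, 1 ≤ P i) → ∀ (Λ : Finset ↥(boxDom (fun i => (ℓ + 1) * (Mh * P i)))),
        IsBlockUnion ℓ (fun i => Mh * P i) Λ → ∀ (μ : Fin (d + 1))
        (x : ↥(Box d ℓ k (fun i => (ℓ + 1) * (Mh * P i)))),
          roww δ ((ℓ + 1) ^ k) (dstar ((ℓ + 1) ^ k) μ (gTwoLevel ((ℓ + 1) ^ k) ℓ aj a m2 (fun i => Mh * P i) Λ)) x
            ≤ C := by
  obtain ⟨δ₃, CR, hδ₃, hCR, hR⟩ := roww_transpose_rOp_le d ℓ hℓ aminus aplus m2plus a2minus a2plus ha ha2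
  obtain ⟨δ₂, C₀, hδ₂, hC₀, hG0⟩ := roww_dstar_gZero_le d ℓ hℓ aminus aplus m2plus a2minus a2plus ha ha2
  refine ⟨min δ₃ δ₂, 2 * CR, 2 * C₀, lt_min hδ₃ hδ₂, by positivity, by positivity, ?_⟩
  intro k hk aj m2 a e1 e2 e3 e4 e5 e6 Mh hMh hM P hP Λ hΛ μ x
  have hMh1 : 1 ≤ Mh := le_trans (by norm_num) hMh
  have hδ0 : 0 ≤ min δ₃ δ₂ := (lt_min hδ₃ hδ₂).le
  have hMpos : (0 : ℝ) < ((ℓ : ℝ) + 1) * Mh := by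
    have : (3 : ℝ) ≤ Mh := by exact_mod_cast hMh
    have : (0 : ℝ) ≤ ℓ := Nat.cast_nonneg ℓ
    positivity
  set G := gTwoLevel ((ℓ + 1) ^ k) ℓ aj a m2 (fun i => Mh * P i) Λ with hG
  set G₀ := B6Eq250.gZero (hDiag ℓ k Mh P) (gPad ℓ k Mh P aj a m2 Λ hP) with hG₀
  set Rm := B6Eq250.rOp (twoLevelOp ((ℓ + 1) ^ k) ℓ aj a m2 (fun i => Mh * P i) Λ) (hDiag ℓ k Mh P)
    (gPad ℓ k Mh P aj a m2 Λ hP) with hRm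
  -- the two inputs at the common rate `min δ₃ δ₂`
  have hRrow : ∀ x', roww (min δ₃ δ₂) ((ℓ + 1) ^ k) Rmᵀ x' ≤ 1 / 2 := by
    intro x'
    refine (roww_mono (min_le_left _ _) _ _ _).trans ((hR k hk aj m2 a e1 e2 e3 e4 e5 e6 Mh hMh P hP Λ hΛ x').trans ?_)
    calc CR / (((ℓ : ℝ) + 1) * Mh) ≤ CR / (2 * CR) := div_le_div_of_nonneg_left hCR.le (by positivity) hM
      _ = 1 / 2 := by field_simp
  have hG0row : ∀ x', roww (min δ₃ δ₂) ((ℓ + 1) ^ k) (dstar ((ℓ + 1) ^ k) μ G₀) x' ≤ C₀ := fun x' =>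
    (roww_mono (min_le_right _ _) _ _ _).trans (hG0 k hk aj m2 a e1 e2 e3 e4 e5 e6 Mh hMh1 P hP Λ μ x')
  -- the transposed fixed point, differenced in the bond variable
  have hfix : G = G₀ + Rmᵀ * G :=
    gTwoLevel_eq_gZero_add_transpose hℓ hk hMh1 hP (lt_of_lt_of_le ha e1) (lt_of_lt_of_le ha2 e5) e3 hΛ
  have hfixD : dstar ((ℓ + 1) ^ k) μ G = dstar ((ℓ + 1) ^ k) μ G₀ + Rmᵀ * dstar ((ℓ + 1) ^ k) μ G := by
    conv_lhs => rw [hfix]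
    rw [dstar_add, dstar_mul]
  -- the maximal weighted bond sum
  obtain ⟨x₀, -, hx₀⟩ := Finset.exists_max_image Finset.univ
    (fun y => roww (min δ₃ δ₂) ((ℓ + 1) ^ k) (dstar ((ℓ + 1) ^ k) μ G) y) ⟨x, Finset.mem_univ x⟩
  have hmax : roww (min δ₃ δ₂) ((ℓ + 1) ^ k) (dstar ((ℓ + 1) ^ k) μ G) x₀
      ≤ C₀ + 1 / 2 * roww (min δ₃ δ₂) ((ℓ + 1) ^ k) (dstar ((ℓ + 1) ^ k) μ G) x₀ := by
    calc roww (min δ₃ δ₂) ((ℓ + 1) ^ k) (dstar ((ℓ + 1) ^ k) μ G) x₀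
        = roww (min δ₃ δ₂) ((ℓ + 1) ^ k) (dstar ((ℓ + 1) ^ k) μ G₀ + Rmᵀ * dstar ((ℓ + 1) ^ k) μ G) x₀ := by
          rw [← hfixD]
      _ ≤ roww (min δ₃ δ₂) ((ℓ + 1) ^ k) (dstar ((ℓ + 1) ^ k) μ G₀) x₀
          + roww (min δ₃ δ₂) ((ℓ + 1) ^ k) (Rmᵀ * dstar ((ℓ + 1) ^ k) μ G) x₀ := roww_add_le _ _ _ _ _
      _ ≤ C₀ + roww (min δ₃ δ₂) ((ℓ + 1) ^ k) Rmᵀ x₀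
          * roww (min δ₃ δ₂) ((ℓ + 1) ^ k) (dstar ((ℓ + 1) ^ k) μ G) x₀ :=
          add_le_add (hG0row x₀) (roww_mul_le hδ0 _ _ _ (fun x' => hx₀ x' (Finset.mem_univ x')) x₀)
      _ ≤ C₀ + 1 / 2 * roww (min δ₃ δ₂) ((ℓ + 1) ^ k) (dstar ((ℓ + 1) ^ k) μ G) x₀ :=
          add_le_add le_rfl (mul_le_mul_of_nonneg_right (hRrow x₀) (roww_nonneg _ _ _ _))
  have hx : roww (min δ₃ δ₂) ((ℓ + 1) ^ k) (dstar ((ℓ + 1) ^ k) μ G) x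
      ≤ roww (min δ₃ δ₂) ((ℓ + 1) ^ k) (dstar ((ℓ + 1) ^ k) μ G) x₀ := hx₀ x (Finset.mem_univ x)
  linarith

/-- **KERNEL DECAY OF `G′∂^*`**: `|ξ^{−1}(G′(x, fwd_μ z) − G′(x, z))| ≤ Ce^{−δ|x−z|_∞/n}` for the genuine two-level box
propagator, same uniformity (by the symmetry of `G′` this is also the decay of the derivative kernel `∂_μG′(·, x)` summed
over its COLUMN). [cite: Balaban1984PropagatorsII, Proposition 2.2 (2.67) p.234] -/
theorem gTwoLevel_dstar_entry_decay (d ℓ : ℕ) (hℓ : 1 ≤ ℓ) (aminus aplus m2plus a2minus a2plus : ℝ) (ha : 0 < aminus)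
    (ha2 : 0 < a2minus) :
    ∃ δ M₀ C : ℝ, 0 < δ ∧ 0 < M₀ ∧ 0 < C ∧ ∀ (k : ℕ), 1 ≤ k → ∀ (aj m2 a : ℝ), aminus ≤ aj → aj ≤ aplus → 0 ≤ m2 →
      m2 ≤ m2plus → a2minus ≤ a → a ≤ a2plus → ∀ (Mh : ℕ), 3 ≤ Mh → M₀ ≤ ((ℓ : ℝ) + 1) * Mh →
        ∀ (P : Fin (d + 1) → ℕ), (∀ i, 1 ≤ P i) → ∀ (Λ : Finset ↥(boxDom (fun i => (ℓ + 1) * (Mh * P i)))),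
        IsBlockUnion ℓ (fun i => Mh * P i) Λ → ∀ (μ : Fin (d + 1))
        (x z : ↥(Box d ℓ k (fun i => (ℓ + 1) * (Mh * P i)))),
          |(((ℓ + 1) ^ k : ℕ) : ℝ) * (gTwoLevel ((ℓ + 1) ^ k) ℓ aj a m2 (fun i => Mh * P i) Λ x (fwd _ μ z)
              - gTwoLevel ((ℓ + 1) ^ k) ℓ aj a m2 (fun i => Mh * P i) Λ x z)|
            ≤ C * Real.exp (-(δ * supNorm (x.1 - z.1) / (((ℓ + 1) ^ k : ℕ) : ℝ))) := by
  obtain ⟨δ, M₀, C, hδ, hM₀, hC, h⟩ := prop22_entry3_twoLevelBox d ℓ hℓ aminus aplus m2plus a2minus a2plus ha ha2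
  refine ⟨δ, M₀, C, hδ, hM₀, hC, ?_⟩
  intro k hk aj m2 a e1 e2 e3 e4 e5 e6 Mh hMh hM P hP Λ hΛ μ x z
  have hrow := h k hk aj m2 a e1 e2 e3 e4 e5 e6 Mh hMh hM P hP Λ hΛ μ x
  have h1 : |dstar ((ℓ + 1) ^ k) μ (gTwoLevel ((ℓ + 1) ^ k) ℓ aj a m2 (fun i => Mh * P i) Λ) x z|
      * Real.exp (δ * supNorm (x.1 - z.1) / (((ℓ + 1) ^ k : ℕ) : ℝ)) ≤ C := by
    refine le_trans ?_ hrow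
    unfold roww
    exact Finset.single_le_sum (f := fun z' => |dstar ((ℓ + 1) ^ k) μ
        (gTwoLevel ((ℓ + 1) ^ k) ℓ aj a m2 (fun i => Mh * P i) Λ) x z'|
        * Real.exp (δ * supNorm (x.1 - z'.1) / (((ℓ + 1) ^ k : ℕ) : ℝ)))
      (fun _ _ => mul_nonneg (abs_nonneg _) (Real.exp_pos _).le) (Finset.mem_univ z)
  rw [dstar_apply] at h1
  have he : Real.exp (δ * supNorm (x.1 - z.1) / (((ℓ + 1) ^ k : ℕ) : ℝ))
      * Real.exp (-(δ * supNorm (x.1 - z.1) / (((ℓ + 1) ^ k : ℕ) : ℝ))) = 1 := by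
    rw [← Real.exp_add, add_neg_cancel, Real.exp_zero]
  calc |(((ℓ + 1) ^ k : ℕ) : ℝ) * (gTwoLevel ((ℓ + 1) ^ k) ℓ aj a m2 (fun i => Mh * P i) Λ x (fwd _ μ z)
          - gTwoLevel ((ℓ + 1) ^ k) ℓ aj a m2 (fun i => Mh * P i) Λ x z)|
      = |(((ℓ + 1) ^ k : ℕ) : ℝ) * (gTwoLevel ((ℓ + 1) ^ k) ℓ aj a m2 (fun i => Mh * P i) Λ x (fwd _ μ z)
          - gTwoLevel ((ℓ + 1) ^ k) ℓ aj a m2 (fun i => Mh * P i) Λ x z)|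
          * Real.exp (δ * supNorm (x.1 - z.1) / (((ℓ + 1) ^ k : ℕ) : ℝ))
          * Real.exp (-(δ * supNorm (x.1 - z.1) / (((ℓ + 1) ^ k : ℕ) : ℝ))) := by rw [mul_assoc, he, mul_one]
    _ ≤ C * Real.exp (-(δ * supNorm (x.1 - z.1) / (((ℓ + 1) ^ k : ℕ) : ℝ))) :=
        mul_le_mul_of_nonneg_right h1 (Real.exp_pos _).le

/-- **THE PRINTED VALUE FORM OF (2.67)₃**: `|(G′∂^{ξ*}_μf)(x)| = |Σ_z ξ^{−1}(G′(x, fwd_μ z) − G′(x, z))f(z)| ≤ Ce^{−δD/n}F`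
for every bond function `f` (`f(z)` the value on `⟨z, z + ξe_μ⟩`) with `|f| ≤ F` supported at sup-distance `≥ D` from
`x` («|(G′∇*λ)(x)| ≤ O(1)L^jηe^{−½δ₀d(y,y′)}|λ|, x ∈ B^j(y), supp λ ⊂ B^{j′}(y′)» in the lattice units of `twoLevelOp`,
where `L^jη ↦ 1`), same uniformity. [cite: Balaban1984PropagatorsII, Proposition 2.2 (2.67) p.234] -/
theorem gTwoLevel_dstar_value_decay (d ℓ : ℕ) (hℓ : 1 ≤ ℓ) (aminus aplus m2plus a2minus a2plus : ℝ) (ha : 0 < aminus)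
    (ha2 : 0 < a2minus) :
    ∃ δ M₀ C : ℝ, 0 < δ ∧ 0 < M₀ ∧ 0 < C ∧ ∀ (k : ℕ), 1 ≤ k → ∀ (aj m2 a : ℝ), aminus ≤ aj → aj ≤ aplus → 0 ≤ m2 →
      m2 ≤ m2plus → a2minus ≤ a → a ≤ a2plus → ∀ (Mh : ℕ), 3 ≤ Mh → M₀ ≤ ((ℓ : ℝ) + 1) * Mh →
        ∀ (P : Fin (d + 1) → ℕ), (∀ i, 1 ≤ P i) → ∀ (Λ : Finset ↥(boxDom (fun i => (ℓ + 1) * (Mh * P i)))),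
        IsBlockUnion ℓ (fun i => Mh * P i) Λ → ∀ (μ : Fin (d + 1))
        (f : ↥(Box d ℓ k (fun i => (ℓ + 1) * (Mh * P i))) → ℝ) (F D : ℝ), (∀ z, |f z| ≤ F) →
        ∀ x : ↥(Box d ℓ k (fun i => (ℓ + 1) * (Mh * P i))), (∀ z, f z ≠ 0 → D ≤ supNorm (x.1 - z.1)) →
          |(dstar ((ℓ + 1) ^ k) μ (gTwoLevel ((ℓ + 1) ^ k) ℓ aj a m2 (fun i => Mh * P i) Λ) *ᵥ f) x|
            ≤ C * Real.exp (-(δ * D / (((ℓ + 1) ^ k : ℕ) : ℝ))) * F := by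
  obtain ⟨δ, M₀, C, hδ, hM₀, hC, h⟩ := prop22_entry3_twoLevelBox d ℓ hℓ aminus aplus m2plus a2minus a2plus ha ha2
  refine ⟨δ, M₀, C, hδ, hM₀, hC, ?_⟩
  intro k hk aj m2 a e1 e2 e3 e4 e5 e6 Mh hMh hM P hP Λ hΛ μ f F D hF x hD
  exact mulVec_le_of_roww hδ.le _ _ x (h k hk aj m2 a e1 e2 e3 e4 e5 e6 Mh hMh hM P hP Λ hΛ μ x) f hF hD

/-- **DICTIONARY CHECK ON `Ω`**: the operator bounded above is `G′∂^{ξ*}_μ` — `⟨g, (dstar G′)f⟩ = ⟨∂^ξ_μ(G′g), f⟩` for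
the (symmetric) genuine two-level box propagator. [cite: Balaban1983RegularityDecay, p. 583 («by duality argument»), dictionary] -/
theorem gTwoLevel_box_dstar_pairing (aj a m2 : ℝ) (Λ : Finset ↥(boxDom (fun i => (ℓ + 1) * (Mh * P i))))
    (μ : Fin (d + 1)) (f g : ↥(Box d ℓ k (fun i => (ℓ + 1) * (Mh * P i))) → ℝ) :
    ∑ x, g x * (dstar ((ℓ + 1) ^ k) μ (gTwoLevel ((ℓ + 1) ^ k) ℓ aj a m2 (fun i => Mh * P i) Λ) *ᵥ f) x
      = ∑ z, f z * ((((ℓ + 1) ^ k : ℕ) : ℝ)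
          * ((gTwoLevel ((ℓ + 1) ^ k) ℓ aj a m2 (fun i => Mh * P i) Λ *ᵥ g) (fwd _ μ z)
            - (gTwoLevel ((ℓ + 1) ^ k) ℓ aj a m2 (fun i => Mh * P i) Λ *ᵥ g) z)) :=
  gTwoLevel_dstar_pairing _ _ _ _ _ _ _ _ _ _

end Prop22Adj

/-! ## §7 Non-vacuity (`d + 1 = 4`, `L = 2`, windows `a_j ∈ [1/2, 2]`, `m² ∈ [0, 1]`, `a ∈ [1/2, 2]`) -/

/-- (2.67)₃ at the physical dimension `d + 1 = 4`, `L = 2`. -/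
example : ∃ δ M₀ C : ℝ, 0 < δ ∧ 0 < M₀ ∧ 0 < C ∧ ∀ (k : ℕ), 1 ≤ k → ∀ (aj m2 a : ℝ), (1 / 2 : ℝ) ≤ aj → aj ≤ 2 →
    0 ≤ m2 → m2 ≤ 1 → (1 / 2 : ℝ) ≤ a → a ≤ 2 → ∀ (Mh : ℕ), 3 ≤ Mh → M₀ ≤ (((1 : ℕ) : ℝ) + 1) * Mh →
      ∀ (P : Fin (3 + 1) → ℕ), (∀ i, 1 ≤ P i) → ∀ (Λ : Finset ↥(boxDom (fun i => (1 + 1) * (Mh * P i)))),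
      IsBlockUnion 1 (fun i => Mh * P i) Λ → ∀ (μ : Fin (3 + 1))
      (x : ↥(Box 3 1 k (fun i => (1 + 1) * (Mh * P i)))),
        roww δ ((1 + 1) ^ k) (dstar ((1 + 1) ^ k) μ (gTwoLevel ((1 + 1) ^ k) 1 aj a m2 (fun i => Mh * P i) Λ)) x
          ≤ C :=
  prop22_entry3_twoLevelBox 3 1 le_rfl (1 / 2) 2 1 (1 / 2) 2 (by norm_num) (by norm_num)

/-- the quantifier prefix is inhabited up to the existential `M₀` (which only asks `M_h ≥ M₀/2`): `k = 1`, the point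
`a_j = a = 1`, `m² = 0` of the window, `M_h = 3`, the unit volume `P ≡ 1`, `Λ = ∅` (a union of blocks), axis `0` and
the site `0` of `Ω`. -/
example : (1 : ℕ) ≤ 1 ∧ (1 / 2 : ℝ) ≤ 1 ∧ (1 : ℝ) ≤ 2 ∧ (0 : ℝ) ≤ 0 ∧ (0 : ℝ) ≤ 1 ∧ (3 : ℕ) ≤ 3
    ∧ (∀ i : Fin (3 + 1), 1 ≤ (fun _ => 1 : Fin (3 + 1) → ℕ) i)
    ∧ IsBlockUnion 1 (fun i => 3 * (fun _ => 1 : Fin (3 + 1) → ℕ) i) ∅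
    ∧ (fun _ => (0 : ℤ)) ∈ Box 3 1 1 (fun i => (1 + 1) * (3 * (fun _ => 1 : Fin (3 + 1) → ℕ) i)) := by
  refine ⟨le_rfl, by norm_num, by norm_num, le_rfl, by norm_num, le_rfl, fun _ => le_rfl, ?_, ?_⟩
  · intro y hy; simp at hy
  · exact mem_boxDom.2 fun _ => ⟨le_rfl, by norm_num⟩

end

end Literature.MathematicalPhysics.QuantumFieldTheory.Balaban1983to89.B6Prop22AdjTwoLevelBox
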